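import Literature.MathematicalPhysics.QuantumFieldTheory.Balaban1983to89.B8Ineq1144TwistedAxial
import Literature.MathematicalPhysics.QuantumFieldTheory.Balaban1983to89.B8Eq156Prop4
import Literature.MathematicalPhysics.QuantumFieldTheory.Balaban1983to89.B7Eq162General
import Literature.MathematicalPhysics.QuantumFieldTheory.Balaban1983to89.B7Prop8PrintedConstants
import Literature.MathematicalPhysics.QuantumFieldTheory.Balaban1983to89.B8Ineq145
import Literature.MathematicalPhysics.QuantumFieldTheory.Balaban1983to89.B8Eq131Derivation
import Literature.MathematicalPhysics.QuantumFieldTheory.Balaban1983to89.B8Eq178Averages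

/-!
# `Balaban1983to89.B8Prop7AdmittedFamily` — [Balaban1985RegularSpaces] **Proposition 7** (p. 100, (1.144)–(1.145)) PROVED as a
# MODEL INSTANCE of the typed printed leaf `B8SectGH.Prop7PrintedR` (v1.2; constant `2α₂` strict) and of the repaired leaf
# `B8Ineq145.Prop7RepairedC C`, every `C ≥ 2` (v1: `C = 3`), on the lineage's `ℤᵈ` carriers, for print's ADMITTED FAMILY
# «Ω_j = T_η, j = 0, 1, …, l» (p. 77) at `l = k`, with print's own gauge transformation `u` ((1.29) + (1.19))

statement-level skeleton of published theorems with citation tags; proofs where landed; nothing here is a claim about the Yang–Mills mass gap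

T. Bałaban, *Spaces of regular gauge field configurations on a lattice and gauge fixing conditions*, Commun. Math. Phys. **99** (1985)
75–102 `[Balaban1985RegularSpaces]` ("B8"; printed page = PDF page + 74).  PDF held: `paper:balaban1985-cmp99-regular-spaces-gauge-fixing`
(lit store; pp. 77, 79, 81, 82, 100 read in the text layer `p0003/p0005/p0007/p0008/p0026.txt` and on the renders
`b2b-balaban-ref1/pages/1985-cmp99-regular-spaces-gauge-fixing/…-p026-x2.png` AS IMAGES).  "[3]" = T. Bałaban, *Averaging operations
for lattice gauge theories*, Commun. Math. Phys. **98** (1985) 17–51 `[Balaban1985Averaging]` ("B7").  STATUS: published, refereed; this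
file ASSEMBLES Proposition 7 on the lineage's concrete carriers from the tree's certified pieces and PROVES the one ingredient print takes
for granted (the `G`-valuedness of the averages, frames and gauge fixing of [3], §1).  Nothing here is new mathematics and nothing here is
a claim about the Clay problem.  Unit `lit-balaban-r05` gen 7 (B8 fold owner; HOME `run/shared/lean/pub/lit-balaban/`; SKELETON row
**B8.Prop7**; cell GAPS G-B8-01), 2026-08-21; v1 p251998 (§1, §2, §4), v1.1 p252490 (§3 + `ineq145_allLevels_admitted_explicit`, append-only), v1.2 p252911 (strict (24) ⇒ `prop7PrintedR_admitted`, append-only), v1.3 (the (1.145) equality at level k, append-only).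

## THE PRINTED TEXT (verbatim)

* p. 100 [PDF 26]: *"We assume that we are given a gauge field configuration U₀, U₀ ∈ 𝔄_k({Ω_j}, α₀), (1.139) and a Lie algebra valued
  configuration A satisfying L^jη|A|, (L^jη)²|∇^η_{U₀}A|, (L^jη)³|D^{η*}_{U₀}D^η_{U₀}A| < α₂ on Ω_j. (1.140)  We consider the configuration
  U₁U₀, U₁ = e^{iηA}."* … *"The Proposition 4 from [3] gives also |Q_j(U₀, ηA)| < 2α₂ on Ω_j^{(j)}. (1.143)  Let us take a gauge
  transformation u satisfying the conditions (1.29) and such that the configuration U′ = (U₁U₀)^u U₀⁻¹ satisfies the axial gauge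
  conditions (1.19). This gauge transformation is determined uniquely. The above bounds imply the following **Proposition 7.** If the
  configurations U₀, A satisfy (1.139), (1.140), then for α₀, α₂ sufficiently small we have U′U₀ = (U₁U₀)^u ∈ 𝔄_k({Ω_j}, α₀ + 3α₂) ∩
  Ax_k(𝔅_k, U₀), (1.144)  |(U′U₀)‾^j − Ū₀^j| = |exp iQ_j(U₀, ηA) − 1| < 2α₂ on Ω^{(j)}_j. (1.145)  This theorem complements Theorem 2."*
* p. 77 [PDF 3]: *"Let us notice that we admit the case where some domains Ω_j are equal to T_η, for example Ω_j = T_η for j = 0, 1, …,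
  l, l ≤ k."*; (1.5) *"Λ_j = Ω_j^{(j)} ∖ Ω_{j+1}^{(j)}, j = 0, 1, …, k − 1, Λ_k = Ω_k^{(k)}"*; p. 78 (1.12) *"𝔅_k = ⋃_{j=0}^k Λ_j"*; p. 77: *"we
  denote by Ω also the set of bonds ⋃_{x∈Ω} st(x) = {bonds b ⊂ T: at least one end-point of b belongs to Ω}"*.
* p. 81 [PDF 7]: *"(\overline{R₀u}ʲ)(y) = 1 for y ∈ Λ_j, j = 0, 1, …, k, (1.29) where the averaging operation … is taken with respect
  to the configuration U₀"*; *"In [3] we have determined the gauge transformation u in terms of the configuration U₁."*; p. 79 [PDF 5]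
  (1.19)–(1.20) (the axial gauge `Ax_k(𝔅_k, U₀)`: for `x_j ∈ Λ_j` and every chain `x_n ∈ B(x_{n+1})` below it
  `(R̄ⁿ_{0,x_{n+1}}Ũ′ⁿ)(Γ_{x_{n+1},x_n}) = 1`, `Ũ′ⁿ = (\overline{U′U₀})ⁿ(Ū₀ⁿ)⁻¹`); p. 78 [PDF 4] (1.17) `U′ᵘ(x,x′) = u(x)U′(x,x′)R(U₀(x,x′))u⁻¹(x′)`;
  p. 82 [PDF 8] (1.35) *"|(\overline{U′U₀})ʲ − Ū₀ʲ| < α₁ on Λ_j, j = 0, 1, …, k"* — the hypothesis of Theorem 2 that (1.145) feeds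
  (*"This theorem complements Theorem 2"*).
* [3] p. 30–31: the averaging condition (81) *"(\overline{R₀u}ᵏ)(y) = 1, y ∈ Ω^{(k)}"*, the block axial gauge (67), the gauge fixing
  *"given by the formulas (77) for j = k − 1 and by (87)"* and (88) *"(\overline{U′U₀})ᵏ(Ū₀ᵏ)⁻¹ = … = U̿₁ᵏ"*; p. 42 (159)–(163); p. 21
  (22)–(24) (the logarithm of a unitary close to `1` is `i`·Hermitian, `|e^{iX} − 1| ≤ |X|`).

## THE FAMILY (print's admitted case) AND WHAT PROPOSITION 7 SAYS FOR IT

For «Ω_j = T_η, j = 0, 1, …, k» the sets (1.5) are `Λ_j = ∅` (`j < k`) and `Λ_k = T^{(k)}`, so `𝔅_k = Λ_k`; (1.139) is (1.7)/(1.9) with the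
level-`j` thresholds on ALL plaquettes/bonds for every `j ≤ k` (the strongest at `j = k`); (1.140) likewise; (1.29) reduces to its top
clause «(\overline{R₀u}ᵏ)(y) = 1 for all y ∈ T^{(k)}» = the averaging condition (81) of [3], and (1.19) for `x_k ∈ Λ_k` is the block axial
gauge (67) of [3] at every level `n < k`: so print's `u` ("determined uniquely") IS the gauge fixing (77) + (87) of [3], the tree's
`B7Eq84Concrete.glev … k 0` (existence `gaugeFixing_exists`, uniqueness `gaugeFixing_unique`), and by (88) (`B7Eq84Concrete.avgIter_glev`)
`(U′U₀)‾ᵏ = U̿₁ᵏ·Ū₀ᵏ` exactly — every bond of `T^{(k)}` is an INTERIOR bond in the sense of p. 81/(1.31), line 1.  This is the geometry in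
which the display (1.145) is right up to its constant (the cell's located failure G-B8-01 of (1.145) lives on the bonds CROSSING `∂Λ_j`, of
which this family has none; r05 g6's `B8Ineq145Lineage.not_prop7Printed_lineage` refutes the typed printed sentence on the half-space
family).  The present file is the POSITIVE counterpart: the whole Proposition, as the repaired leaf `B8Ineq145.Prop7RepairedC C`
((1.145) ↦ (1.35) on `Λ_j` at constant `C·α₂`, hypotheses (1.139)/(1.140) via pv17's `B8SectGH.GFData3.C140`), INHABITED with `C = 3`
(v1) and, via the STRICT form of (24) of [3] (v1.2, `norm_exp_sub_one_lt_of_mem_unitary`), the typed PRINTED leaf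
`B8SectGH.Prop7PrintedR` itself (constant `2α₂`, strict) — hence `Prop7RepairedC C` for every `C ≥ 2`.

## WHAT IS CERTIFIED HERE (kernel; `theorem`s `sorry`-free, axioms `propext`/`Classical.choice`/`Quot.sound`)

* §1 (C⋆-algebra `𝔸`, `G = U(𝔸) = B7Prop2Explicit.unitaryUnits`, `U₀` and `U₁ = e^{B}` `G`-valued, the Prop.-2/Prop.-4 windows of
  [3] @gen for `U₀` and for `U₁U₀`, `sup|B| ≤ b`, `2048·d·Lᵏb ≤ 1`): `tHol_mem_unitaryUnits`, **`wframe_mem_unitaryUnits`** (the block frame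
  (82) is unitary when its twisted transports are within `1/4` of `1`), `tild_eq_of_mgauge` ((93) solved), `avgIter_mem_unitaryUnits`,
  `avgIter_mul_mem_unitaryUnits`, `twist_le_quarter`, **`dbavgCovIter_vcov_mem_unitaryUnits`** (`U̿₁ʲ` (90)/(91) and `v_j` (97) are unitary,
  `j ≤ k`, by induction), **`glev_mem_unitaryUnits`** (the gauge fixing `u` of [3] is unitary at every level and site),
  `norm_dbavgCovIter_top_sub_one_le` (`|(U̿₁ᵏ)_b − 1| ≤ |Q_k| ≤ 2Lᵏb`, via `B7Eq162General.level_facts` = `U̿ = e^{Q}` + (161)/(1.143), and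
  (24) `B7Prop8PrintedConstants.norm_exp_sub_one_le_of_mem_unitary`), **`norm_avgIter_fixed_sub_le`** (`|(U′U₀)‾ᵏ_b − (Ū₀ᵏ)_b| ≤ 2Lᵏb` for
  `U′ = U₁^{u}`, by (88)); (v1.2) the STRICT (24) **`norm_exp_sub_one_lt_of_star_eq_neg`**/**`norm_exp_sub_one_lt_of_mem_unitary`**
  (`|e^{X} − 1| < r` for skew-adjoint `X` with `|X| ≤ r`, `r > 0`, from Mathlib's `‖e^{ix} − 1‖² = 2(1 − cos‖x‖)` and the strict
  `1 − θ²/2 < cos θ`), `norm_dbavgCovIter_top_sub_one_lt` (`|(U̿₁ᵏ)_b − 1| < 2Lᵏb` when `Lᵏb > 0`), **`norm_avgIter_fixed_sub_lt`**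
  (`|(U′U₀)‾ᵏ_b − (Ū₀ᵏ)_b| < 2Lᵏb`); (v1.3) THE EQUALITY of (1.145) at level `k` **`norm_avgIter_fixed_sub_eq`**
  (`|(U′U₀)‾ᵏ_b − (Ū₀ᵏ)_b| = |e^{Q_k,b} − 1|`, `Q_k = B7Prop4GeneralLevels.logCovIter`, by (88) and `|XV| = |X|` for unitary `V`).
* §2 `LamTop` (= `Λ_j` of the admitted family) with `lamTop_self`/`lamTop_of_ne`/`eq_of_mem_lamTop`/`eq_of_bondTouches_lamTop`;
  **`restr129_glev`** ((1.29) `B8Eq119TwistedAxial.Restr129` for `u = glev`, every `U₀, U₁`, via `eq81_glev` and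
  `B8Eq178Averages.restr129_iff_uavg`); **`inAx_glev`** ((1.19)/the `Ax_k(𝔅_k, U₀)`-clause of (1.144) `B8Eq119TwistedAxial.InAx` for
  `U′U₀ = (U₁U₀)^u`, every `U₀, U₁`, via `axialGauge_glev` and `B8Eq131Derivation.ax119_iff_ax67`); `mgauge_mul_eq_gaugeAct_mulCfg`
  ((1.17): `U′U₀ = (U₁U₀)^u`).  (The two tree spellings of `e^{B}`, `B7Prop3Flat.expCfg` and `B8Eq146AExpansion.expCfg`, agree by `rfl`.)
* §3 (v1.1; same standing hypotheses as §1): the printed domain «on Ω_j^{(j)}» = `T^{(j)}` at EVERY level `j ≤ k` —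
  `norm_dbavgCovIter_sub_one_le` (`|(U̿₁ʲ)_b − 1| ≤ 2Lʲb`), `norm_vcov_sub_one_le` ((163) @gen: `|v_j − 1|, |v_j⁻¹ − 1| ≤ 64dLʲb`),
  `norm_tildIter_sub_one_le` (`|Ũ₁ʲ_b − 1| ≤ 130dLʲb`), `norm_tHol_tildIter_sub_one_le` (the twisted tree transports behind (162):
  `≤ 128dLʲb + 4dLʲ⁺¹b`), **`norm_glev_sub_one_le`** (print's `u` read at every level `j ≤ k` is within `200dLᵏb` of `1`: the recursion
  (76)/(77) telescoped), `norm_tildIter_fixed_sub_one_le` (`|Ũ′ʲ_b − 1| ≤ 530dLᵏb` for `U′ = U₁^{u}`), **`norm_avgIter_fixed_sub_le_all`**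
  (`|(U′U₀)‾ʲ_b − (Ū₀ʲ)_b| ≤ 530dLᵏb` at every bond of `T^{(j)}`, every `j ≤ k`).
* §4 `cst d L` (explicit `c(d, L) > 0`, `cst_pos`), the packaging **`admittedGF d L 𝔸 : ℕ × {η > 0} → B8SectGH.GFData3`** (index `(k, η)`)
  and **`toAxialGF`** (`U₁ ↦ U′ = U₁^{glev}`); **`prop7_admitted_explicit`** (all inputs explicit: for `0 < α₀, α₂ ≤ c(d,L)`, `U(𝔸)`-valued
  `U₀ ∈ 𝔄_k({T_η,…}, α₀)`, Hermitian `A` with (1.140) at the top level on all bonds: `u` unitary-valued, (1.144) `𝔄_k`-clause for EVERY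
  family `{Ω_j}` (p40's `B8Ineq1144ClassAk.inAk_mulCfg_gaugeAct_hermitian`), (1.144) `Ax_k`-clause, (1.29), and
  `|(U′U₀)‾ᵏ_b − (Ū₀ᵏ)_b| ≤ 2α₂` at EVERY bond of `T^{(k)}`); **`prop7RepairedC_admitted : B8Ineq145.Prop7RepairedC 3 (admittedGF d L 𝔸)
  (toAxialGF d L _ 𝔸)`** for every `d ≥ 1`, `L ≥ 2`, every C⋆-algebra `𝔸`; `prop7RepairedC_admitted_of_le` (every `C ≥ 3`);
  (v1.1) **`ineq145_allLevels_admitted_explicit`** (under the hypotheses of `prop7_admitted_explicit` minus the third member of (1.140):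
  `|(U′U₀)‾ʲ_b − (Ū₀ʲ)_b| ≤ 530d·α₂` at every bond of `T^{(j)}`, `j = 0, 1, …, k` — the INEQUALITY of (1.145) on its printed domain, with a
  `d`-dependent constant), the shared preamble `standing` (private); (v1.2) **`ineq145_top_strict_admitted_explicit`**
  (`|(U′U₀)‾ᵏ_b − (Ū₀ᵏ)_b| < 2α₂`, print's constant, strict, every bond of `T^{(k)}`), **`prop7PrintedR_admitted :
  B8SectGH.Prop7PrintedR (admittedGF d L 𝔸) (toAxialGF d L _ 𝔸)`** (THE TYPED PRINTED PROPOSITION 7, pv17's faithful form, holds for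
  the admitted family — every `d ≥ 1`, `L ≥ 2`, C⋆-algebra `𝔸`), `prop7RepairedC_admitted_of_two_le` (every `C ≥ 2`, via
  `B8Ineq145.prop7RepairedC_of_printedR`); (v1.3) **`display145_top_admitted_explicit`** — the display (1.145) at level `k` AS
  PRINTED, all three members: `|(U′U₀)‾ᵏ_b − (Ū₀ᵏ)_b| = |exp Q_k(U₀, iηA)_b − 1|`, `|Q_k(U₀, iηA)_b| ≤ 2α₂` ((1.143), non-strict as
  certified), `|exp Q_k − 1| < 2α₂`, at every bond of `T^{(k)}`.

## DICTIONARY / HONEST SCOPE — what is NOT claimed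

(i) `T_η ↦ ℤᵈ` at every level (the lineage's standing dictionary, `B7Prop1Explicit`/`B7Prop2Explicit`; no wrap-around), lattice spacing
`η > 0` explicit; `M_N(ℂ) ⊃ U(N)` ↦ a C⋆-algebra `𝔸` with `G = U(𝔸)`; "Lie algebra valued A" ↦ `A(b)` self-adjoint, `U₁ = e^{iηA}`
(`B8Eq146AExpansion.iEta`/`expCfg`); `∇^η_{U₀}A` componentwise (`B8Ineq132.covDerivFwd`), `D^{η*}_{U₀}D^η_{U₀}A = pdiv ∘ plaqCovDeriv` (the
readings of the (1.141)/(1.142) certificates `B8Ineq1141SectG`).  (ii) ONE admissible family per `(k, η)`: print's admitted case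
«Ω_j = T_η» at `l = k` — a special case of Proposition 7, not the general admissible `{Ω_j}` of (1.3)/(1.4) (for which the bonds crossing
`∂Λ_j` carry the located constants-only erratum G-B8-01; the general localisation of (1.139)/(1.140) is `B8Ineq1144ClassAk` HONEST SCOPE
(i)).  (iii) (1.145) is read, as in the typed leaves `B8.Prop7Printed`/`B8SectGH.Prop7PrintedR`/`B8Ineq145.Prop7RepairedC`, through the
(1.35)-predicate `avgClose` «on Λ_j» (pv17 DIVERGENCE D-pv17.4); for this family that is EVERY bond of `T^{(k)}` at level `k` (where v1.3's
`display145_top_admitted_explicit` certifies the display itself, equality included) and nothing at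
the levels `j < k` (there, on `Ω_j^{(j)} = T^{(j)}`, the EQUALITY in (1.145) fails on the tree bonds of the axial gauge — `B8Ineq145` (a) —
and the INEQUALITY holds with a `d`-dependent constant: §3/`ineq145_allLevels_admitted_explicit` certify `≤ 530d·α₂` on every bond of
`T^{(j)}`, every `j ≤ k`; the constant `530d` is this file's bookkeeping (u within `200dα₂`, `v_j` within `64dα₂`, `U̿` within `2α₂` of `1`,
both ends), not a printed one, and no attempt is made to optimise it).  (iv) CONSTANT: the tree's (131)/(1.143) `|Q_k(U₀, ηA)| ≤ 2α₂` is NON-strict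
(`B7Eq123General.prop4_general`), so v1 certified `≤ 2α₂ < 3α₂` and inhabited `Prop7RepairedC 3`; v1.2 recovers print's STRICT `< 2α₂`
at level `k` from the strict (24) (`|e^{iX} − 1| < r` for `|X| ≤ r`, `r > 0` — print's own `max_j |sin(λ_j/2)/(λ_j/2)|·|λ_j|`
argument, the maximum over the spectrum being attained), so the typed printed leaf `Prop7PrintedR` is inhabited and `Prop7RepairedC C`
for every `C ≥ 2`; the all-levels constant `530d` of §3 is not sharpened.  (v) «for α₀, α₂ sufficiently small» ↦ the explicit `c(d, L) = cst d L` (minimum of the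
input windows: `1/(80d)`, `1/(24C₀(d))`, `c₂′(d,L)/16`, `1/(32000(d+1)²(d+4))`, `2⁻²¹(d+1)⁻²`, `c₃(d,L)/2`, `1/(2048d)`); the strict
pointwise (1.7) is summed into `sup ≤ α₀L^{−2k} < 2α₀L^{−2k}` (`B8Ineq1144TwistedAxial.pdev_le_of_forall`), and (1.141) into
`sup ≤ (α₀ + 3α₂)L^{−2k}` (`pdev_mulCfg_le`), so the windows are used at `2α₀` and `2(α₀ + 3α₂)`.  (vi) The fields of `GFData3` not read by
Proposition 7 (Theorems 2/4/8, Props. 3/5/6: (1.36)–(1.39), (1.62), (1.146), (3.35), `act`, `fNorm`, `fGrad`, `InR`) are trivial data on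
these carriers, as in `B8Ineq145Lineage.lineageGF7`; consequently `B8Ineq145.thm2_after_prop7RepairedC` is not instantiated here (its
Theorem-2 hypothesis is the abstract leaf).  (vii) p40 g4's `B8Ineq1144TwistedAxial.prop7_1144` proves (1.144) for the tree's OTHER axial
representative `twGauge` (normalised by `u(Lᵏy) = 1`); here `u` is print's (1.29)-normalised one — same (1.14)-orbit, different
representative; only the `𝔄_k`-clause (valid for every unitary `u`) is shared.

[cite: Balaban1985RegularSpaces, Prop. 7 (1.144)–(1.145) p.100, (1.139)–(1.140) p.100, (1.143) p.100, (1.29) p.81, (1.19)–(1.20) p.79,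
(1.17) p.78, (1.35) p.82, (1.5) p.77, p.77 («Ω_j = T_η»); Balaban1985Averaging, (81)–(88) pp.30–31, (67) p.29, (76)–(77) pp.29–30,
(89)–(92) p.31, (97) p.32, (159)–(163) p.42, (22)–(24) p.21]
-/

noncomputable section

open scoped BigOperators
open NormedSpace Finset

namespace Literature.MathematicalPhysics.QuantumFieldTheory.Balaban1983to89.B8Prop7AdmittedFamily

open B7Prop1Explicit B7Prop2Explicit B7Prop3Flat MatrixLog B7Eq92Concrete B7Eq99Concrete B7Eq84Concrete
open B7Prop4GeneralLevels (logCovIter)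
open B7Eq162General (level_facts norm_twist_general)
open B7Prop8PrintedConstants (norm_exp_sub_one_le_of_mem_unitary Rc_mem_unitaryUnits)
open B8Lemma1NonAbelian (mulCfg)
open B8Eq146AExpansion (iEta plaqCovDeriv norm_iEta_le)
open B8Eq143PlaqExpansion (pdiv)
open B8Ineq132 (InAk CondAt BondTouches plaqF covDiv covDerivFwd)
open B8Eq119TwistedAxial (InAx Restr129)
open B8Eq131Derivation (ax119_iff_ax67)
open B8Eq178Averages (restr129_iff_uavg)
open B8Eq155JBound (expCfg_iEta_mem_unitaryUnits expCfg_iEta_mem_U1 norm_expCfg_iEta_sub_one_le_of_141)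
open B8Ineq1144ClassAk (inAk_mulCfg_gaugeAct_hermitian forall_of_inAk_univ)
open B8Ineq1144TwistedAxial (pdev_le_of_forall pdev_mulCfg_le)
open B8Ineq130 (fl)

-- `Site` alone would resolve to the torus sites of `Setup.lean`; re-export the `ℤ^d` sites of `B7Prop1Explicit`.
export B7Prop1Explicit (Site)

variable {d : ℕ}

/-! ## §1 The unitarity chain (C⋆-algebra `𝔸`, gauge group `G = U(𝔸)`): the double-bar averages `U̿₁ʲ` (90)/(91), the block frames
(82), the frames `v_j` (97)/(160) and the gauge fixing `u` of [3] ((77) + (87), `B7Eq84Concrete.glev`) are UNITARY-VALUED in the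
small-field regime

Print takes the `G`-valuedness of every average and frame for granted ([3] p. 18: *"configurations with values in a Lie subgroup G
of a unitary group U(N)"*; p. 21 (22)–(24); p. 44: *"all operations needed to define R̄₀uᵏ are done always in a case where proper
expressions are small"*).  On the lineage's carriers it is a theorem, proved along the templates of gen 20's
`B7Prop2Explicit.bavg_mem_unitaryUnits` and p05's `B7Prop8PrintedConstants.uavg_mem_unitaryUnits`: a real combination of logarithms
of unitaries within `1/4` of `1` is skew-adjoint ((22)–(23), `B7Prop2Explicit.star_mlog_eq_neg`), so its exponential is unitary; the
rest is group algebra ((89)/(91), (92) in the form `B7Eq92Concrete.tildIter_eq_mgauge`, (76)/(87) in the form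
`B7Eq84Concrete.glev_of_lt`/`glev_top`) and the `G`-valuedness of the plain averages (43) (`B7Prop2Explicit.avgIter_mem`). -/

section Unitarity

variable {𝔸 : Type*} [CStarAlgebra 𝔸]

/-- The twisted transport (58) `(R_{0,y}W)(Γ) = (WV₀)(Γ)·V₀(Γ)⁻¹` of unitary-valued `V₀`, `W` is unitary.
[cite: Balaban1985Averaging, (58) p.27] -/
theorem tHol_mem_unitaryUnits {V₀ W : Site d → Fin d → 𝔸ˣ} (hV₀ : ∀ x κ, V₀ x κ ∈ unitaryUnits 𝔸)
    (hW : ∀ x κ, W x κ ∈ unitaryUnits 𝔸) (y : Site d) (w : List (Letter d)) :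
    tHol V₀ W y w ∈ unitaryUnits 𝔸 := by
  unfold tHol
  refine (unitaryUnits 𝔸).mul_mem (hol_mem_of (fun x κ => ?_) y w) ((unitaryUnits 𝔸).inv_mem (hol_mem_of hV₀ y w))
  rw [Pi.mul_apply]
  exact (unitaryUnits 𝔸).mul_mem (hW x κ) (hV₀ x κ)

/-- **The block frame (82) `\overline{R_{0,y}W} = exp[Σ_{x∈B(y)} L^{−d} log (R_{0,y}W)(Γ_{y,x})]` is unitary** when `V₀`, `W` are
unitary-valued and every twisted transport along the block contours is within `1/4` of `1` ((22)–(23): the logarithms are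
skew-adjoint, Mathlib `NormedSpace.exp_mem_unitary_of_mem_skewAdjoint`). [cite: Balaban1985Averaging, (82) p.30, (22)–(23) p.21] -/
theorem wframe_mem_unitaryUnits (L : ℕ) {V₀ W : Site d → Fin d → 𝔸ˣ} (hV₀ : ∀ x κ, V₀ x κ ∈ unitaryUnits 𝔸)
    (hW : ∀ x κ, W x κ ∈ unitaryUnits 𝔸) (y : Site d)
    (hsmall : ∀ r : Fin d → Fin L, ‖((tHol V₀ W y (treeWord (boxVec L r)) : 𝔸ˣ) : 𝔸) - 1‖ ≤ 1 / 4) :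
    wframe L V₀ W y ∈ unitaryUnits 𝔸 := by
  have hF : Fcov L V₀ W y ∈ skewAdjoint 𝔸 := by
    unfold Fcov
    refine sum_mem fun r _ => skewAdjoint.smul_mem _ ?_
    rw [skewAdjoint.mem_iff]
    exact star_mlog_eq_neg ((mem_unitaryUnits).1 (tHol_mem_unitaryUnits hV₀ hW y _)) (hsmall r)
  letI : NormedAlgebra ℚ 𝔸 := NormedAlgebra.restrictScalars ℚ ℂ 𝔸
  rw [mem_unitaryUnits, wframe, val_expUnit]
  exact NormedSpace.exp_mem_unitary_of_mem_skewAdjoint hF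

/-- **(89) through (92)/(93), pure group algebra**: for ANY frame function `v`, the one-step average `Ṽ` (65) of `W` is recovered
from that of the moved field `W^{v}` (55): `W̃(c) = v(c₋)⁻¹·\widetilde{W^{v}}(c)·R̄_{0,c}v(c₊)` (`B7Eq92Concrete.tild_mgauge` solved
for `W̃`). [cite: Balaban1985Averaging, (93) p.32, (59) p.27] -/
theorem tild_eq_of_mgauge (L : ℕ) (V₀ W : Site d → Fin d → 𝔸ˣ) (v : Site d → 𝔸ˣ) (q : Site d) (κ : Fin d) :
    tild L V₀ W q κ
      = (v q)⁻¹ * tild L V₀ (mgauge V₀ v W) q κ * Rc (bavg L V₀ q κ) (v (q + (L : ℤ) • e κ)) := by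
  rw [tild_mgauge]
  group

variable [Nontrivial 𝔸]

/-- **(24) p. 21, STRICT form**: for a skew-adjoint `X` (`X = iA`, `A` hermitian) and `0 < r`, `‖X‖ ≤ r` implies `‖e^{X} − 1‖ < r`
(print: `|U − 1| = max_j |e^{iλ_j} − 1| = max_j |sin(λ_j/2)/(λ_j/2)|·|λ_j|`, and `|sin s/s| < 1` for `s ≠ 0`, the maximum being attained;
here from Mathlib's `‖e^{ix} − 1‖² = 2(1 − cos‖x‖)` (`selfAdjoint.norm_sq_expUnitary_sub_one`) and the strict `1 − θ²/2 < cos θ`, `θ ≠ 0`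
(`Real.one_sub_sq_div_two_lt_cos`); the non-strict form is `B7Prop8PrintedConstants.norm_exp_sub_one_le_of_star_eq_neg`).
[cite: Balaban1985Averaging, (24) p.21] -/
theorem norm_exp_sub_one_lt_of_star_eq_neg {X : 𝔸} (hX : star X = -X) {r : ℝ} (hr : 0 < r)
    (hXr : ‖X‖ ≤ r) : ‖exp X - 1‖ < r := by
  have hsa : IsSelfAdjoint ((-Complex.I) • X) := by
    rw [IsSelfAdjoint, star_smul, hX, Complex.star_def, map_neg, Complex.conj_I, neg_neg, smul_neg, neg_smul]
  have h1 : ((selfAdjoint.expUnitary (⟨(-Complex.I) • X, hsa⟩ : selfAdjoint 𝔸) : unitary 𝔸) : 𝔸) = exp X := by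
    rw [selfAdjoint.expUnitary_coe]
    simp only [smul_smul, mul_neg, Complex.I_mul_I, neg_neg, one_smul]
  have h2 : ‖(⟨(-Complex.I) • X, hsa⟩ : selfAdjoint 𝔸)‖ = ‖X‖ := by
    rw [AddSubgroup.coe_norm]
    show ‖(-Complex.I) • X‖ = ‖X‖
    rw [norm_smul, norm_neg, Complex.norm_I, one_mul]
  rw [← h1]
  by_cases hπ : ‖(⟨(-Complex.I) • X, hsa⟩ : selfAdjoint 𝔸)‖ ≤ Real.pi
  · by_cases h0 : ‖X‖ = 0
    · have hX0 : X = 0 := norm_eq_zero.mp h0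
      subst hX0
      have : (⟨(-Complex.I) • (0 : 𝔸), hsa⟩ : selfAdjoint 𝔸) = 0 := by ext; simp
      rw [this, selfAdjoint.expUnitary_zero, OneMemClass.coe_one, sub_self, norm_zero]
      exact hr
    · have hsq : ‖((selfAdjoint.expUnitary (⟨(-Complex.I) • X, hsa⟩ : selfAdjoint 𝔸) : unitary 𝔸) : 𝔸) - 1‖ ^ 2
          < r ^ 2 := by
        rw [selfAdjoint.norm_sq_expUnitary_sub_one hπ, h2]
        have hc := Real.one_sub_sq_div_two_lt_cos h0
        have : ‖X‖ ^ 2 ≤ r ^ 2 := pow_le_pow_left₀ (norm_nonneg _) hXr 2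
        linarith
      exact (pow_lt_pow_iff_left₀ (norm_nonneg _) hr.le two_ne_zero).mp hsq
  · push Not at hπ
    rw [h2] at hπ
    calc ‖((selfAdjoint.expUnitary (⟨(-Complex.I) • X, hsa⟩ : selfAdjoint 𝔸) : unitary 𝔸) : 𝔸) - 1‖
        ≤ ‖((selfAdjoint.expUnitary (⟨(-Complex.I) • X, hsa⟩ : selfAdjoint 𝔸) : unitary 𝔸) : 𝔸)‖ + ‖(1 : 𝔸)‖ :=
          norm_sub_le _ _
      _ = 2 := by rw [CStarRing.norm_coe_unitary, CStarRing.norm_one]; norm_num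
      _ < r := by linarith [Real.pi_gt_three]

/-- **(22)–(24) combined, STRICT**: if `e^{X}` is unitary, `‖X‖ ≤ 1/5`, `0 < r` and `‖X‖ ≤ r`, then `‖e^{X} − 1‖ < r` (`X = log e^{X}`
is skew-adjoint by (22)–(23), `B7Prop2Explicit.star_mlog_eq_neg`; then (24) strict).  This is what turns the tree's NON-STRICT
(131)/(1.143) `|Q_k| ≤ 2α₂` into print's STRICT (1.145) `|exp iQ_k − 1| < 2α₂`. [cite: Balaban1985Averaging, (22)–(24) p.21] -/
theorem norm_exp_sub_one_lt_of_mem_unitary {X : 𝔸} (hU : exp X ∈ unitary 𝔸) (hs : ‖X‖ ≤ 1 / 5)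
    {r : ℝ} (hr : 0 < r) (hXr : ‖X‖ ≤ r) : ‖exp X - 1‖ < r := by
  have h1 : ‖exp X - 1‖ ≤ 1 / 4 := by
    have := B7Transfer.norm_exp_sub_one_le_of_le X hs
    linarith [B7Eq31BCH.exp_one_fifth_le]
  have hstar : star (mlog (exp X)) = -mlog (exp X) := star_mlog_eq_neg hU h1
  rw [B7Eq170Flat.mlog_exp_of_le hs] at hstar
  exact norm_exp_sub_one_lt_of_star_eq_neg hstar hr hXr

section Tower

variable {L k : ℕ} {U₀ : Site d → Fin d → 𝔸ˣ} {B : Site d → Fin d → 𝔸} {α₀ αP b : ℝ}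
  (hd : 1 ≤ d) (hL : 2 ≤ L) (hU₀ : ∀ x κ, U₀ x κ ∈ unitaryUnits 𝔸) (hBu : ∀ x κ, expCfg B x κ ∈ unitaryUnits 𝔸)
  (hα : 0 < α₀) (hα3 : C0 d * α₀ ≤ 1 / 3) (hα4 : 4 * α₀ ≤ c2' d L) (h52 : pdev U₀ < α₀ * (((L : ℝ) ^ k)⁻¹) ^ 2)
  (hb : 0 ≤ b) (hB : ∀ x κ, ‖B x κ‖ ≤ b)
  (hsmall : Real.exp (4 * (800 * ((d : ℝ) + 1) ^ 2 * ((d : ℝ) + 4)) * α₀)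
    * (1 + 8 * (131072 * ((d : ℝ) + 1) ^ 2) * ((L : ℝ) ^ k * b)) ≤ 2)
  (hc₃ : 2 * ((L : ℝ) ^ k * b) ≤ c3 d L) (hsm : 2048 * (d : ℝ) * ((L : ℝ) ^ k * b) ≤ 1)
  (hαP : 0 < αP) (hαP3 : C0 d * αP ≤ 1 / 3) (hαP2 : 2 * αP ≤ c2' d L)
  (hP : pdev (expCfg B * U₀) < αP * (((L : ℝ) ^ k)⁻¹) ^ 2)

include hL hU₀ hα hα3 hα4 h52 in
/-- *"we can apply Proposition 1 to the configuration Ūʲ"* ([3] p. 26) — all averaged backgrounds `Ū₀ʲ`, `j ≤ k`, are unitary-valued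
(`B7Prop2Explicit.avgIter_mem` for `G = U(𝔸)`, under (52) `|U₀(∂p) − 1| < α₀L^{−2k}` and the Prop.-2 window).
[cite: Balaban1985Averaging, (52)–(53) p.26; Balaban1985RegularSpaces, (1.139) p.100] -/
theorem avgIter_mem_unitaryUnits : ∀ j ≤ k, ∀ (x : Site d) (κ : Fin d), avgIter L U₀ j x κ ∈ unitaryUnits 𝔸 :=
  avgIter_mem L hL (avgClosed_unitaryUnits d L) k U₀ hU₀ hα hα3 (by linarith) h52

include hL hU₀ hBu hαP hαP3 hαP2 hP in
/-- The same for the product configuration `U₁U₀`, `U₁ = e^{B}` unitary-valued, under its own (52)-window (in Prop. 7: (1.141)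
«|(U₁U₀)(∂p) − 1| < (α₀ + 3α₂)L^{−2j}»): every `\overline{U₁U₀}ʲ`, `j ≤ k`, is unitary-valued.
[cite: Balaban1985Averaging, (52)–(53) p.26; Balaban1985RegularSpaces, (1.141) p.100] -/
theorem avgIter_mul_mem_unitaryUnits :
    ∀ j ≤ k, ∀ (x : Site d) (κ : Fin d), avgIter L (expCfg B * U₀) j x κ ∈ unitaryUnits 𝔸 :=
  avgIter_mem L hL (avgClosed_unitaryUnits d L) k (expCfg B * U₀)
    (fun x κ => by rw [Pi.mul_apply]; exact (unitaryUnits 𝔸).mul_mem (hBu x κ) (hU₀ x κ)) hαP hαP3 hαP2 hP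

include hd hL hb hsm in
/-- Level arithmetic: `4dL^{j+1}b ≤ 1/4` for `j < k` and `2Lʲb ≤ 1/5` for `j ≤ k`, from `2048·d·Lᵏb ≤ 1` (`d ≥ 1`, `L ≥ 2`). [folklore] -/
private theorem level_small' :
    (∀ j < k, 4 * (d : ℝ) * ((L : ℝ) ^ (j + 1) * b) ≤ 1 / 4) ∧ ∀ j ≤ k, 2 * ((L : ℝ) ^ j * b) ≤ 1 / 5 := by
  have hL1 : (1 : ℝ) ≤ L := by exact_mod_cast le_trans (by norm_num) hL
  have hd1 : (1 : ℝ) ≤ d := by exact_mod_cast hd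
  have hmono : ∀ j ≤ k, (L : ℝ) ^ j * b ≤ (L : ℝ) ^ k * b := fun j hj =>
    mul_le_mul_of_nonneg_right (pow_le_pow_right₀ hL1 hj) hb
  have hkb : 0 ≤ (L : ℝ) ^ k * b := by positivity
  refine ⟨fun j hj => ?_, fun j hj => ?_⟩
  · have h1 := mul_le_mul_of_nonneg_left (hmono (j + 1) hj) (by positivity : (0 : ℝ) ≤ 4 * d)
    nlinarith
  · have h1 := hmono j hj
    nlinarith

include hd hL hU₀ hα hα3 hα4 h52 hb hB hsmall hc₃ hsm in
/-- The twisted transports `(R̄ʲ_{0,y}U̿₁ʲ)(Γ_{y,x})` along the block contours are within `1/4` of `1` at every level `j < k`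
(`B7Eq162General.norm_twist_general`: `≤ 4dL^{j+1}b`, and `4dL^{j+1}b ≤ 4dLᵏb ≤ 1/512`). [cite: Balaban1985Averaging, (159)–(162) p.42] -/
theorem twist_le_quarter {j : ℕ} (hj : j < k) (y : Site d) (r : Fin d → Fin L) :
    ‖((tHol (avgIter L U₀ j) (dbavgCovIter L U₀ (expCfg B) j) y (treeWord (boxVec L r)) : 𝔸ˣ) : 𝔸) - 1‖ ≤ 1 / 4 :=
  (norm_twist_general hL (avgClosed_unitaryUnits d L) hU₀ hα hα3 hα4 h52 hb hB hsmall hc₃ hsm hj y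
    (l1_boxVec_le L r)).trans ((level_small' hd hL hb hsm).1 j hj)

include hd hL hU₀ hBu hα hα3 hα4 h52 hb hB hsmall hc₃ hsm hαP hαP3 hαP2 hP in
/-- **`U̿₁ʲ` (90)/(91) and the frames `v_j` (97)/(160) are unitary-valued, `j ≤ k`** — by induction on `j`: the block frame (82) of
`U̿₁ʲ` at `Ū₀ʲ` is unitary (`wframe_mem_unitaryUnits`, `twist_le_quarter`), hence `v_{j+1} = v_j·\overline{R̄ʲ_{0,·}U̿₁ʲ}` is; and by
(89) with (93) (`tild_eq_of_mgauge` at the frame `v_j`, `Ũ₁ʲ = (U̿₁ʲ)^{v_j}` (92)/(97) `B7Eq92Concrete.tildIter_eq_mgauge`) the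
double-bar average `U̿₁^{j+1}(c) = (frame)⁻¹·v_j(c₋)⁻¹·\overline{U₁U₀}^{j+1}(c)·(Ū₀^{j+1}(c))⁻¹·R̄_{0,c}v_j(c₊)·R̄_{0,c}(frame)` is a
product of unitaries (the plain averages (43) by `avgIter_mem`). [cite: Balaban1985Averaging, (89)–(92) p.31, (97) p.32, (82) p.30] -/
theorem dbavgCovIter_vcov_mem_unitaryUnits :
    ∀ j ≤ k, (∀ (z : Site d) (κ : Fin d), dbavgCovIter L U₀ (expCfg B) j z κ ∈ unitaryUnits 𝔸) ∧
      ∀ z : Site d, vcov L U₀ (expCfg B) j z ∈ unitaryUnits 𝔸 := by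
  intro j
  induction j with
  | zero =>
    intro _
    exact ⟨fun z κ => by rw [dbavgCovIter_zero]; exact hBu z κ,
      fun z => by rw [vcov_zero]; exact (unitaryUnits 𝔸).one_mem⟩
  | succ j ih =>
    intro hj1
    have hjk : j < k := Nat.lt_of_succ_le hj1
    obtain ⟨hW, hv⟩ := ih hjk.le
    have hV₀ := avgIter_mem_unitaryUnits hL hU₀ hα hα3 hα4 h52 j hjk.le
    have hfr : ∀ y : Site d,
        wframe L (avgIter L U₀ j) (dbavgCovIter L U₀ (expCfg B) j) y ∈ unitaryUnits 𝔸 := fun y =>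
      wframe_mem_unitaryUnits L hV₀ hW y
        (fun r => twist_le_quarter hd hL hU₀ hα hα3 hα4 h52 hb hB hsmall hc₃ hsm hjk y r)
    refine ⟨fun z κ => ?_, fun z => ?_⟩
    · -- `U̿₁^{j+1}(c)`, `c = ⟨Lz, Lz + Le_κ⟩` read on the `(j+1)`-st lattice
      have h1 : avgIter L (expCfg B * U₀) (j + 1) z κ ∈ unitaryUnits 𝔸 :=
        avgIter_mul_mem_unitaryUnits hL hU₀ hBu hαP hαP3 hαP2 hP (j + 1) hj1 z κ
      have h2 : avgIter L U₀ (j + 1) z κ ∈ unitaryUnits 𝔸 :=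
        avgIter_mem_unitaryUnits hL hU₀ hα hα3 hα4 h52 (j + 1) hj1 z κ
      have htild : tild L (avgIter L U₀ j) (tildIter L U₀ (expCfg B) j) ((L : ℤ) • z) κ ∈ unitaryUnits 𝔸 := by
        rw [tild_apply, tildIter_mul]
        exact (unitaryUnits 𝔸).mul_mem h1 ((unitaryUnits 𝔸).inv_mem h2)
      have hbavg : bavg L (avgIter L U₀ j) ((L : ℤ) • z) κ ∈ unitaryUnits 𝔸 := h2
      rw [dbavgCovIter_succ, dbavgCov_apply,
        tild_eq_of_mgauge L (avgIter L U₀ j) (dbavgCovIter L U₀ (expCfg B) j) (vcov L U₀ (expCfg B) j),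
        ← tildIter_eq_mgauge L U₀ (expCfg B) j]
      refine (unitaryUnits 𝔸).mul_mem ((unitaryUnits 𝔸).mul_mem ((unitaryUnits 𝔸).inv_mem (hfr _)) ?_)
        (Rc_mem_unitaryUnits hbavg (hfr _))
      exact (unitaryUnits 𝔸).mul_mem ((unitaryUnits 𝔸).mul_mem ((unitaryUnits 𝔸).inv_mem (hv _)) htild)
        (Rc_mem_unitaryUnits hbavg (hv _))
    · rw [vcov_succ]
      exact (unitaryUnits 𝔸).mul_mem (hv _) (hfr _)

include hd hL hU₀ hBu hα hα3 hα4 h52 hb hB hsmall hc₃ hsm hαP hαP3 hαP2 hP in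
/-- **The gauge fixing `u` of [3] is unitary-valued at every level**: `u_j = glev … k j` ((87) `u_k = (\overline{R_{0,·}U₁^{(k)}})⁻¹ =
v_k⁻¹` at the top, (76) `u_j(x) = R(Ū₀ʲ(Γ_{y,x}))⁻¹[u_{j+1}(y)(R̄ʲ_{0,y}Ũ₁ʲ)(Γ_{y,x})]` below), all factors unitary
(`dbavgCovIter_vcov_mem_unitaryUnits`, `B7Eq99Concrete.wrec_eq_vcov`; `(R̄ʲ_{0,y}Ũ₁ʲ)(Γ) = \overline{U₁U₀}ʲ(Γ)·Ū₀ʲ(Γ)⁻¹` by (69)).  B8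
p. 81: *"In [3] we have determined the gauge transformation u in terms of the configuration U₁"*.
[cite: Balaban1985Averaging, (76)–(77) pp.29–30, (87) p.31; Balaban1985RegularSpaces, p.81] -/
theorem glev_mem_unitaryUnits (hL1 : 1 ≤ L) :
    ∀ j ≤ k, ∀ x : Site d, glev L hL1 U₀ (expCfg B) k j x ∈ unitaryUnits 𝔸 := by
  -- downward induction on the depth `m = k − j`
  suffices h : ∀ m j : ℕ, j + m = k → ∀ x : Site d, glev L hL1 U₀ (expCfg B) k j x ∈ unitaryUnits 𝔸 by
    intro j hj x
    exact h (k - j) j (by omega) x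
  intro m
  induction m with
  | zero =>
    intro j hjk x
    have hj : j = k := by omega
    rw [hj, glev_top, wrec_eq_vcov]
    exact (unitaryUnits 𝔸).inv_mem
      ((dbavgCovIter_vcov_mem_unitaryUnits hd hL hU₀ hBu hα hα3 hα4 h52 hb hB hsmall hc₃ hsm hαP hαP3 hαP2 hP
        k le_rfl).2 x)
  | succ m ih =>
    intro j hjm x
    have hjk : j < k := by omega
    have hV₀ := avgIter_mem_unitaryUnits hL hU₀ hα hα3 hα4 h52 j hjk.le
    have hV₁ := avgIter_mul_mem_unitaryUnits hL hU₀ hBu hαP hαP3 hαP2 hP j hjk.le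
    rw [glev_of_lt L hL1 U₀ (expCfg B) hjk]
    refine Rc_mem_unitaryUnits ((unitaryUnits 𝔸).inv_mem (hol_mem_of hV₀ _ _))
      ((unitaryUnits 𝔸).mul_mem (ih (j + 1) (by omega) _) ?_)
    -- `(R̄ʲ_{0,y}Ũ₁ʲ)(Γ) = \overline{U₁U₀}ʲ(Γ)·Ū₀ʲ(Γ)⁻¹`
    unfold tHol
    rw [tildIter_mul]
    exact (unitaryUnits 𝔸).mul_mem (hol_mem_of hV₁ _ _) ((unitaryUnits 𝔸).inv_mem (hol_mem_of hV₀ _ _))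

include hd hL hU₀ hBu hα hα3 hα4 h52 hb hB hsmall hc₃ hsm hαP hαP3 hαP2 hP in
/-- **(1.145) at the top level, the right member**: `|(U̿₁ᵏ)_b − 1| = |exp iQ_k(U₀, ηA) − 1| ≤ |Q_k(U₀, ηA)| ≤ 2Lᵏb` — the double-bar
average IS `e^{Q_k}` (`B7Eq123General.dbavgCovIter_eq_expCfg_logCovIter`, via `B7Eq162General.level_facts`), (161)/(1.143) `|Q_k| ≤ 2Lᵏb`
(Prop. 4 of [3] @gen, `B7Eq123General.prop4_general`; in B8's currency `B8Eq156Prop4.ineq1143`), and (24) `|e^{X} − 1| ≤ |X|` for the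
skew-adjoint `X = iQ_k` (`e^{X} = (U̿₁ᵏ)_b` unitary, `B7Prop8PrintedConstants.norm_exp_sub_one_le_of_mem_unitary`).
[cite: Balaban1985RegularSpaces, (1.145) p.100, (1.143) p.100; Balaban1985Averaging, (161) p.42, (24) p.21] -/
theorem norm_dbavgCovIter_top_sub_one_le (z : Site d) (κ : Fin d) :
    ‖((dbavgCovIter L U₀ (expCfg B) k z κ : 𝔸ˣ) : 𝔸) - 1‖ ≤ 2 * ((L : ℝ) ^ k * b) := by
  obtain ⟨-, hW, hQ⟩ := level_facts hL (avgClosed_unitaryUnits d L) hU₀ hα hα3 hα4 h52 hb hB hsmall hc₃ k le_rfl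
  have hmem := (dbavgCovIter_vcov_mem_unitaryUnits hd hL hU₀ hBu hα hα3 hα4 h52 hb hB hsmall hc₃ hsm hαP hαP3 hαP2
    hP k le_rfl).1 z κ
  rw [hW] at hmem ⊢
  have hval : ((expCfg (logCovIter L U₀ B k) z κ : 𝔸ˣ) : 𝔸) = exp (logCovIter L U₀ B k z κ) := rfl
  rw [mem_unitaryUnits, hval] at hmem
  rw [hval]
  have h5 : ‖logCovIter L U₀ B k z κ‖ ≤ 1 / 5 := (hQ z κ).trans ((level_small' hd hL hb hsm).2 k le_rfl)
  exact (norm_exp_sub_one_le_of_mem_unitary hmem h5).trans (hQ z κ)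

include hd hL hU₀ hBu hα hα3 hα4 h52 hb hB hsmall hc₃ hsm hαP hαP3 hαP2 hP in
/-- **(1.145) at the top level, the left member, for THE gauge-fixed field `U′ = U₁^{u}`**: `|(U′U₀)‾ᵏ_b − (Ū₀ᵏ)_b| ≤ 2Lᵏb` — by (88)
`(U′U₀)‾ᵏ = U̿₁ᵏ·Ū₀ᵏ` for `u = glev` (`B7Eq84Concrete.avgIter_glev`: in the block axial gauge with the averaging condition no frame is left
over), so `(U′U₀)‾ᵏ_b − (Ū₀ᵏ)_b = ((U̿₁ᵏ)_b − 1)(Ū₀ᵏ)_b` with `(Ū₀ᵏ)_b` unitary. [cite: Balaban1985RegularSpaces, (1.145) p.100; Balaban1985Averaging, (88) p.31] -/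
theorem norm_avgIter_fixed_sub_le (hL1 : 1 ≤ L) (z : Site d) (κ : Fin d) :
    ‖((avgIter L (mgauge U₀ (glev L hL1 U₀ (expCfg B) k 0) (expCfg B) * U₀) k z κ : 𝔸ˣ) : 𝔸)
        - ((avgIter L U₀ k z κ : 𝔸ˣ) : 𝔸)‖ ≤ 2 * ((L : ℝ) ^ k * b) := by
  rw [avgIter_glev L hL1 U₀ (expCfg B) k]
  simp only [Pi.mul_apply, Units.val_mul]
  have hY : ‖((avgIter L U₀ k z κ : 𝔸ˣ) : 𝔸)‖ ≤ 1 :=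
    (unitaryUnits_le_U1 (avgIter_mem_unitaryUnits hL hU₀ hα hα3 hα4 h52 k le_rfl z κ)).1
  have hX := norm_dbavgCovIter_top_sub_one_le hd hL hU₀ hBu hα hα3 hα4 h52 hb hB hsmall hc₃ hsm hαP hαP3 hαP2 hP z κ
  have key : ((dbavgCovIter L U₀ (expCfg B) k z κ : 𝔸ˣ) : 𝔸) * ((avgIter L U₀ k z κ : 𝔸ˣ) : 𝔸)
      - ((avgIter L U₀ k z κ : 𝔸ˣ) : 𝔸)
        = (((dbavgCovIter L U₀ (expCfg B) k z κ : 𝔸ˣ) : 𝔸) - 1) * ((avgIter L U₀ k z κ : 𝔸ˣ) : 𝔸) := by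
    noncomm_ring
  rw [key]
  calc _ ≤ ‖((dbavgCovIter L U₀ (expCfg B) k z κ : 𝔸ˣ) : 𝔸) - 1‖ * ‖((avgIter L U₀ k z κ : 𝔸ˣ) : 𝔸)‖ :=
        norm_mul_le _ _
    _ ≤ 2 * ((L : ℝ) ^ k * b) * 1 := mul_le_mul hX hY (norm_nonneg _) (by positivity)
    _ = _ := mul_one _

include hd hL hU₀ hBu hα hα3 hα4 h52 hb hB hsmall hc₃ hsm hαP hαP3 hαP2 hP in
/-- **(1.145) at the top level, the right member, with print's STRICT constant**: `|(U̿₁ᵏ)_b − 1| = |exp iQ_k(U₀, ηA) − 1| < 2Lᵏb`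
whenever `Lᵏb > 0` — the non-strict `|Q_k| ≤ 2Lᵏb` of (161)/(1.143) @gen followed by the STRICT (24)
(`norm_exp_sub_one_lt_of_mem_unitary`: `|e^{X} − 1| < r` for skew-adjoint `X` with `|X| ≤ r`, `r > 0`).
[cite: Balaban1985RegularSpaces, (1.145) p.100, (1.143) p.100; Balaban1985Averaging, (161) p.42, (24) p.21] -/
theorem norm_dbavgCovIter_top_sub_one_lt (hpos : 0 < (L : ℝ) ^ k * b) (z : Site d) (κ : Fin d) :
    ‖((dbavgCovIter L U₀ (expCfg B) k z κ : 𝔸ˣ) : 𝔸) - 1‖ < 2 * ((L : ℝ) ^ k * b) := by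
  obtain ⟨-, hW, hQ⟩ := level_facts hL (avgClosed_unitaryUnits d L) hU₀ hα hα3 hα4 h52 hb hB hsmall hc₃ k le_rfl
  have hmem := (dbavgCovIter_vcov_mem_unitaryUnits hd hL hU₀ hBu hα hα3 hα4 h52 hb hB hsmall hc₃ hsm hαP hαP3 hαP2
    hP k le_rfl).1 z κ
  rw [hW] at hmem ⊢
  have hval : ((expCfg (logCovIter L U₀ B k) z κ : 𝔸ˣ) : 𝔸) = exp (logCovIter L U₀ B k z κ) := rfl
  rw [mem_unitaryUnits, hval] at hmem
  rw [hval]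
  have h5 : ‖logCovIter L U₀ B k z κ‖ ≤ 1 / 5 := (hQ z κ).trans ((level_small' hd hL hb hsm).2 k le_rfl)
  exact norm_exp_sub_one_lt_of_mem_unitary hmem h5 (by positivity) (hQ z κ)

include hd hL hU₀ hBu hα hα3 hα4 h52 hb hB hsmall hc₃ hsm hαP hαP3 hαP2 hP in
/-- **(1.145) ↦ (1.35) at the top level with print's STRICT constant**, for `U′ = U₁^{u}`, `u = glev`:
`|(U′U₀)‾ᵏ_b − (Ū₀ᵏ)_b| < 2Lᵏb` at every bond (`Lᵏb > 0`), by (88) and `norm_dbavgCovIter_top_sub_one_lt`.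
[cite: Balaban1985RegularSpaces, (1.145) p.100, (1.35) p.82; Balaban1985Averaging, (88) p.31] -/
theorem norm_avgIter_fixed_sub_lt (hL1 : 1 ≤ L) (hpos : 0 < (L : ℝ) ^ k * b) (z : Site d) (κ : Fin d) :
    ‖((avgIter L (mgauge U₀ (glev L hL1 U₀ (expCfg B) k 0) (expCfg B) * U₀) k z κ : 𝔸ˣ) : 𝔸)
        - ((avgIter L U₀ k z κ : 𝔸ˣ) : 𝔸)‖ < 2 * ((L : ℝ) ^ k * b) := by
  rw [avgIter_glev L hL1 U₀ (expCfg B) k]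
  simp only [Pi.mul_apply, Units.val_mul]
  have hY : ‖((avgIter L U₀ k z κ : 𝔸ˣ) : 𝔸)‖ ≤ 1 :=
    (unitaryUnits_le_U1 (avgIter_mem_unitaryUnits hL hU₀ hα hα3 hα4 h52 k le_rfl z κ)).1
  have hX := norm_dbavgCovIter_top_sub_one_lt hd hL hU₀ hBu hα hα3 hα4 h52 hb hB hsmall hc₃ hsm hαP hαP3 hαP2 hP hpos z κ
  have key : ((dbavgCovIter L U₀ (expCfg B) k z κ : 𝔸ˣ) : 𝔸) * ((avgIter L U₀ k z κ : 𝔸ˣ) : 𝔸)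
      - ((avgIter L U₀ k z κ : 𝔸ˣ) : 𝔸)
        = (((dbavgCovIter L U₀ (expCfg B) k z κ : 𝔸ˣ) : 𝔸) - 1) * ((avgIter L U₀ k z κ : 𝔸ˣ) : 𝔸) := by
    noncomm_ring
  rw [key]
  calc _ ≤ ‖((dbavgCovIter L U₀ (expCfg B) k z κ : 𝔸ˣ) : 𝔸) - 1‖ * ‖((avgIter L U₀ k z κ : 𝔸ˣ) : 𝔸)‖ :=
        norm_mul_le _ _
    _ ≤ ‖((dbavgCovIter L U₀ (expCfg B) k z κ : 𝔸ˣ) : 𝔸) - 1‖ * 1 :=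
        mul_le_mul_of_nonneg_left hY (norm_nonneg _)
    _ < 2 * ((L : ℝ) ^ k * b) * 1 := by rw [mul_one, mul_one]; exact hX
    _ = _ := mul_one _

include hL hU₀ hα hα3 hα4 h52 hb hB hsmall hc₃ in
/-- **(1.145) at the top level, THE EQUALITY as printed**: `|(U′U₀)‾ᵏ_b − (Ū₀ᵏ)_b| = |exp Q_k(U₀, B)_b − 1|` for `U′ = U₁^{u}`,
`u = glev` — by (88) `(U′U₀)‾ᵏ = U̿₁ᵏ·Ū₀ᵏ`, `U̿₁ᵏ = e^{Q_k}` (`B7Eq162General.level_facts`; `Q_k = B7Prop4GeneralLevels.logCovIter`,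
print's `iQ_k(U₀, ηA)` for `B = iηA`), and `|X·V| = |X|` for unitary `V = (Ū₀ᵏ)_b` (C⋆-norm, Mathlib `CStarRing.norm_mul_mem_unitary`).
[cite: Balaban1985RegularSpaces, (1.145) p.100; Balaban1985Averaging, (88) p.31, (159)–(161) p.42] -/
theorem norm_avgIter_fixed_sub_eq (hL1 : 1 ≤ L) (z : Site d) (κ : Fin d) :
    ‖((avgIter L (mgauge U₀ (glev L hL1 U₀ (expCfg B) k 0) (expCfg B) * U₀) k z κ : 𝔸ˣ) : 𝔸)
        - ((avgIter L U₀ k z κ : 𝔸ˣ) : 𝔸)‖ = ‖exp (logCovIter L U₀ B k z κ) - 1‖ := by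
  obtain ⟨-, hW, -⟩ := level_facts hL (avgClosed_unitaryUnits d L) hU₀ hα hα3 hα4 h52 hb hB hsmall hc₃ k le_rfl
  rw [avgIter_glev L hL1 U₀ (expCfg B) k]
  simp only [Pi.mul_apply, Units.val_mul]
  have hU : ((avgIter L U₀ k z κ : 𝔸ˣ) : 𝔸) ∈ unitary 𝔸 :=
    (mem_unitaryUnits).1 (avgIter_mem_unitaryUnits hL hU₀ hα hα3 hα4 h52 k le_rfl z κ)
  have key : ((dbavgCovIter L U₀ (expCfg B) k z κ : 𝔸ˣ) : 𝔸) * ((avgIter L U₀ k z κ : 𝔸ˣ) : 𝔸)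
      - ((avgIter L U₀ k z κ : 𝔸ˣ) : 𝔸)
        = (((dbavgCovIter L U₀ (expCfg B) k z κ : 𝔸ˣ) : 𝔸) - 1) * ((avgIter L U₀ k z κ : 𝔸ˣ) : 𝔸) := by
    noncomm_ring
  rw [key, CStarRing.norm_mul_mem_unitary _ hU, hW]
  rfl

end Tower

end Unitarity

/-! ## §2 Print's gauge transformation `u` for the admitted family: (1.29) and the axial gauge (1.19) = the `Ax_k`-clause of (1.144)

For the admitted family «Ω_j = T_η, j = 0, …, k» the sets (1.5) are `Λ_j = Ω_j^{(j)} ∖ Ω_{j+1}^{(j)} = ∅` (`j < k`), `Λ_k = Ω_k^{(k)} =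
T^{(k)}` (`LamTop`), so `𝔅_k = Λ_k` and (1.29) reads «(\overline{R₀u}ᵏ)(y) = 1 for every y ∈ T^{(k)}» = the averaging condition (81) of [3],
while (1.19) for `x_k ∈ Λ_k` is the block axial gauge (67) of [3] at every level `n < k` (B8 p. 81: *"In [3] we have determined the gauge
transformation u in terms of the configuration U₁"*).  Both hold for `u = B7Eq84Concrete.glev … k 0` for EVERY `U₀`, `U₁` (pure
algebra: `eq81_glev`, `axialGauge_glev`), and that `u` is unique (`B7Eq84Concrete.gaugeFixing_unique`) — print p. 100: *"This gauge
transformation is determined uniquely."* -/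

section Gauge

/-- The sets (1.5) of the admitted family «Ω_j = T_η, j ≤ k»: `Λ_k = T^{(k)}`, `Λ_j = ∅` for `j ≠ k`.
[cite: Balaban1985RegularSpaces, (1.5)–(1.6) p.77 (with «Ω_j = T_η for j = 0, 1, …, l», p.77)] -/
def LamTop (k : ℕ) : ℕ → Set (Site d) := fun j => if j = k then Set.univ else ∅

/-- `Λ_k = T^{(k)}`. [cite: Balaban1985RegularSpaces, (1.5) p.77] -/
@[simp] theorem lamTop_self (k : ℕ) : LamTop (d := d) k k = Set.univ := by simp [LamTop]

/-- `Λ_j = ∅` for `j ≠ k`. [cite: Balaban1985RegularSpaces, (1.5) p.77] -/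
theorem lamTop_of_ne {k j : ℕ} (h : j ≠ k) : LamTop (d := d) k j = ∅ := by simp [LamTop, h]

/-- Membership in `Λ_j` forces `j = k`. [cite: Balaban1985RegularSpaces, (1.5) p.77] -/
theorem eq_of_mem_lamTop {k j : ℕ} {y : Site d} (hy : y ∈ LamTop k j) : j = k := by
  by_contra h
  simp [lamTop_of_ne h] at hy

/-- A bond «on `Λ_j`» (p. 77 convention) exists only at `j = k`. [cite: Balaban1985RegularSpaces, p.77 (bond convention), (1.5) p.77] -/
theorem eq_of_bondTouches_lamTop {k j : ℕ} {z : Site d} {κ : Fin d} (h : BondTouches (LamTop k j) z κ) : j = k := by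
  rcases h with h | h
  exacts [eq_of_mem_lamTop h, eq_of_mem_lamTop h]

variable {𝔸 : Type*} [NormedRing 𝔸] [NormedAlgebra ℂ 𝔸] [CompleteSpace 𝔸]

/-- **(1.29) for `u = glev`**: «(\overline{R₀u}ʲ)(y) = 1 for y ∈ Λ_j, j = 0, 1, …, k» — here only `j = k` is non-void, and there it is
the averaging condition (81) of [3] (`B7Eq84Concrete.eq81_glev`; the typed (1.29) `B8Eq119TwistedAxial.Restr129` is read through
`B8Eq178Averages.restr129_iff_uavg`).  Every `U₀`, `U₁`, no smallness. [cite: Balaban1985RegularSpaces, (1.29) p.81; Balaban1985Averaging, (81) p.30] -/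
theorem restr129_glev (L : ℕ) (hL1 : 1 ≤ L) (k : ℕ) (U₀ U₁ : Site d → Fin d → 𝔸ˣ) :
    Restr129 L k (LamTop k) U₀ (glev L hL1 U₀ U₁ k 0) := by
  rw [restr129_iff_uavg]
  intro j _ y hy
  obtain rfl := eq_of_mem_lamTop hy
  exact eq81_glev L hL1 U₀ U₁ j y

/-- **(1.19) = the `Ax_k(𝔅_k, U₀)`-clause of (1.144) for `U′U₀ = (U₁U₀)^u`, `u = glev`**: for `x_k ∈ Λ_k = T^{(k)}` and every chain below it
the conditions (1.19) are the block axial gauge conditions (67) of [3] at the levels `n < k` (`B8Eq131Derivation.ax119_iff_ax67`), which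
`glev` satisfies on every block (`B7Eq84Concrete.axialGauge_glev`); `U′ = U₁^{u}` in the moving frame (55) = (1.17), so `U′U₀ = (U₁U₀)^u`
(`B7Eq92Concrete.mgauge_mul`).  Every `U₀`, `U₁`, no smallness. [cite: Balaban1985RegularSpaces, (1.19) p.79, (1.144) p.100; Balaban1985Averaging, (67) p.29] -/
theorem inAx_glev (L : ℕ) (hL1 : 1 ≤ L) (k : ℕ) (U₀ U₁ : Site d → Fin d → 𝔸ˣ) :
    InAx L k (LamTop k) U₀ (mgauge U₀ (glev L hL1 U₀ U₁ k 0) U₁ * U₀) := by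
  intro j _ hjk xj hxj n hn z _ r
  obtain rfl := eq_of_mem_lamTop hxj
  rw [ax119_iff_ax67]
  exact axialGauge_glev L hL1 U₀ U₁ j n hn z r

omit [NormedAlgebra ℂ 𝔸] [CompleteSpace 𝔸] in
/-- `U′U₀ = (U₁U₀)^u` for `U′ = U₁^{u}` in the moving frame (1.17)/(55) (a pointer to `B7Eq92Concrete.mgauge_mul` in B8's product
notation `B8Lemma1NonAbelian.mulCfg`). [cite: Balaban1985RegularSpaces, (1.17) p.78, (1.144) p.100; Balaban1985Averaging, (55) p.27] -/
theorem mgauge_mul_eq_gaugeAct_mulCfg (U₀ U₁ : Site d → Fin d → 𝔸ˣ) (u : Site d → 𝔸ˣ) :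
    mgauge U₀ u U₁ * U₀ = gaugeAct u (mulCfg U₁ U₀) :=
  mgauge_mul U₀ u U₁


end Gauge

/-! ## §3 The printed domain «on Ω_j^{(j)}», ALL levels `j ≤ k`: the INEQUALITY of (1.145) with a `d`-dependent constant

For the admitted family `Ω_j^{(j)} = T^{(j)}` at every level, while the typed leaves read (1.145) only on `Λ_j` (= level `k` here; HONEST
SCOPE (iii)).  At a level `j < k` the EQUALITY in (1.145) fails on the tree bonds of the axial gauge (`B8Ineq145` (a)), but the INEQUALITY
`|(U′U₀)‾ʲ_b − (Ū₀ʲ)_b| < C·α₂` holds on every bond with a constant `C = C(d)`: by (70)/(71) (`B7Eq92Concrete.tildIter_mgauge`) and (97)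
(`tildIter_eq_mgauge`) `Ũ′ʲ_b = u_j(b₋)·v_j(b₋)·(U̿₁ʲ)_b·R̄ʲ_{0,b}v_j(b₊)⁻¹·R̄ʲ_{0,b}u_j(b₊)⁻¹`, where print's `u` read at level `j` is within
`200dLᵏb` of `1` (the recursion (76)/(77) `B7Eq84Concrete.glev_of_lt` telescoped with (163) and the twist bound behind (162)), `v_j`
within `64dLʲb` ((163) @gen, `B7Eq162General.eq163_general`) and `(U̿₁ʲ)_b` within `|Q_j| ≤ 2Lʲb` ((161)/(1.143)); hence
`|Ũ′ʲ_b − 1| ≤ 530dLᵏb = 530d·α₂`. -/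

section AllLevels

variable {𝔸 : Type*} [CStarAlgebra 𝔸] [Nontrivial 𝔸]

variable {L k : ℕ} {U₀ : Site d → Fin d → 𝔸ˣ} {B : Site d → Fin d → 𝔸} {α₀ αP b : ℝ}
  (hd : 1 ≤ d) (hL : 2 ≤ L) (hU₀ : ∀ x κ, U₀ x κ ∈ unitaryUnits 𝔸) (hBu : ∀ x κ, expCfg B x κ ∈ unitaryUnits 𝔸)
  (hα : 0 < α₀) (hα3 : C0 d * α₀ ≤ 1 / 3) (hα4 : 4 * α₀ ≤ c2' d L) (h52 : pdev U₀ < α₀ * (((L : ℝ) ^ k)⁻¹) ^ 2)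
  (hb : 0 ≤ b) (hB : ∀ x κ, ‖B x κ‖ ≤ b)
  (hsmall : Real.exp (4 * (800 * ((d : ℝ) + 1) ^ 2 * ((d : ℝ) + 4)) * α₀)
    * (1 + 8 * (131072 * ((d : ℝ) + 1) ^ 2) * ((L : ℝ) ^ k * b)) ≤ 2)
  (hc₃ : 2 * ((L : ℝ) ^ k * b) ≤ c3 d L) (hsm : 2048 * (d : ℝ) * ((L : ℝ) ^ k * b) ≤ 1)
  (hαP : 0 < αP) (hαP3 : C0 d * αP ≤ 1 / 3) (hαP2 : 2 * αP ≤ c2' d L)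
  (hP : pdev (expCfg B * U₀) < αP * (((L : ℝ) ^ k)⁻¹) ^ 2)

omit [Nontrivial 𝔸] in
/-- `|abc − 1| ≤ |a − 1| + |b − 1| + |c − 1|` for `a, b ∈ {|u| ≤ 1, |u⁻¹| ≤ 1}` (print's tacit bookkeeping behind (163)/(164)). [folklore] -/
private theorem norm_mul₃_units_sub_one_le [NormOneClass 𝔸] {a b c : 𝔸ˣ} (ha : a ∈ U1 𝔸) (hb' : b ∈ U1 𝔸) :
    ‖((a * b * c : 𝔸ˣ) : 𝔸) - 1‖ ≤ ‖(a : 𝔸) - 1‖ + ‖(b : 𝔸) - 1‖ + ‖(c : 𝔸) - 1‖ :=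
  (B8Lemma1NonAbelian.norm_units_mul_sub_one_le ((U1 𝔸).mul_mem ha hb')).trans
    (by linarith [B8Lemma1NonAbelian.norm_units_mul_sub_one_le (q := b) ha])

include hd hL hb hsm in
/-- Level arithmetic: `2Lʲb ≤ 2Lᵏb`, `Lʲb ≤ Lᵏb` for `j ≤ k`, and `Lᵏb ≤ 1/2048`. [folklore] -/
private theorem level_mono {j : ℕ} (hj : j ≤ k) : (L : ℝ) ^ j * b ≤ (L : ℝ) ^ k * b ∧ (L : ℝ) ^ k * b ≤ 1 / 2048 := by
  have hL1 : (1 : ℝ) ≤ L := by exact_mod_cast le_trans (by norm_num) hL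
  have hd1 : (1 : ℝ) ≤ d := by exact_mod_cast hd
  have hkb : 0 ≤ (L : ℝ) ^ k * b := by positivity
  exact ⟨mul_le_mul_of_nonneg_right (pow_le_pow_right₀ hL1 hj) hb, by nlinarith⟩

include hd hL hU₀ hBu hα hα3 hα4 h52 hb hB hsmall hc₃ hsm hαP hαP3 hαP2 hP in
/-- **(161)/(1.143) with (24), every level**: `|(U̿₁ʲ)_b − 1| ≤ |Q_j(U₀, ηA)| ≤ 2Lʲb` for `j ≤ k` (`U̿₁ʲ = e^{Q_j}` unitary,
`B7Eq162General.level_facts`, `B7Prop8PrintedConstants.norm_exp_sub_one_le_of_mem_unitary`).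
[cite: Balaban1985RegularSpaces, (1.143) p.100; Balaban1985Averaging, (161) p.42, (24) p.21] -/
theorem norm_dbavgCovIter_sub_one_le {j : ℕ} (hj : j ≤ k) (z : Site d) (κ : Fin d) :
    ‖((dbavgCovIter L U₀ (expCfg B) j z κ : 𝔸ˣ) : 𝔸) - 1‖ ≤ 2 * ((L : ℝ) ^ j * b) := by
  obtain ⟨-, hW, hQ⟩ := level_facts hL (avgClosed_unitaryUnits d L) hU₀ hα hα3 hα4 h52 hb hB hsmall hc₃ j hj
  have hmem := (dbavgCovIter_vcov_mem_unitaryUnits hd hL hU₀ hBu hα hα3 hα4 h52 hb hB hsmall hc₃ hsm hαP hαP3 hαP2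
    hP j hj).1 z κ
  rw [hW] at hmem ⊢
  have hval : ((expCfg (logCovIter L U₀ B j) z κ : 𝔸ˣ) : 𝔸) = exp (logCovIter L U₀ B j z κ) := rfl
  rw [mem_unitaryUnits, hval] at hmem
  rw [hval]
  have h5 : ‖logCovIter L U₀ B j z κ‖ ≤ 1 / 5 := by
    have := (hQ z κ).trans (mul_le_mul_of_nonneg_left (level_mono hd hL hb hsm hj).1 (by norm_num : (0:ℝ) ≤ 2))
    linarith [(level_mono hd hL hb hsm hj).2]
  exact (norm_exp_sub_one_le_of_mem_unitary hmem h5).trans (hQ z κ)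

include hL hU₀ hα hα3 hα4 h52 hb hB hsmall hc₃ hsm in
/-- **(163) @gen, simplified**: `|v_j(y) − 1|, |v_j(y)⁻¹ − 1| ≤ 64dLʲb` for `j ≤ k` (`B7Eq162General.eq163_general`).
[cite: Balaban1985Averaging, (163) p.42] -/
theorem norm_vcov_sub_one_le {j : ℕ} (hj : j ≤ k) (y : Site d) :
    ‖((vcov L U₀ (expCfg B) j y : 𝔸ˣ) : 𝔸) - 1‖ ≤ 64 * (d : ℝ) * ((L : ℝ) ^ j * b) ∧
      ‖(((vcov L U₀ (expCfg B) j y)⁻¹ : 𝔸ˣ) : 𝔸) - 1‖ ≤ 64 * (d : ℝ) * ((L : ℝ) ^ j * b) := by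
  obtain ⟨⟨h1, h2⟩, h64⟩ := B7Eq162General.eq163_general hL (avgClosed_unitaryUnits d L) hU₀ hα hα3 hα4 h52 hb hB hsmall
    hc₃ hsm hj y
  exact ⟨h1.trans h64, h2.trans h64⟩

include hd hL hU₀ hBu hα hα3 hα4 h52 hb hB hsmall hc₃ hsm hαP hαP3 hαP2 hP in
/-- **`Ũ₁ʲ` is within `130dLʲb` of `1`** at every bond, `j ≤ k`: by (97)/(92) `(Ũ₁ʲ)_b = v_j(b₋)(U̿₁ʲ)_b R̄ʲ_{0,b}v_j(b₊)⁻¹`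
(`B7Eq92Concrete.tildIter_eq_mgauge`) with (163) for the frames and (161) for `U̿₁ʲ`. [cite: Balaban1985Averaging, (97) p.32, (161)–(163) p.42] -/
theorem norm_tildIter_sub_one_le {j : ℕ} (hj : j ≤ k) (z : Site d) (κ : Fin d) :
    ‖((tildIter L U₀ (expCfg B) j z κ : 𝔸ˣ) : 𝔸) - 1‖ ≤ 130 * (d : ℝ) * ((L : ℝ) ^ j * b) := by
  have hd1 : (1 : ℝ) ≤ d := by exact_mod_cast hd
  obtain ⟨hW, hv⟩ := dbavgCovIter_vcov_mem_unitaryUnits hd hL hU₀ hBu hα hα3 hα4 h52 hb hB hsmall hc₃ hsm hαP hαP3 hαP2 hP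
    j hj
  have hV₀ := avgIter_mem_unitaryUnits hL hU₀ hα hα3 hα4 h52 j hj
  rw [tildIter_eq_mgauge L U₀ (expCfg B) j, mgauge_apply]
  have ha : vcov L U₀ (expCfg B) j z ∈ U1 𝔸 := unitaryUnits_le_U1 (hv z)
  have hb' : dbavgCovIter L U₀ (expCfg B) j z κ ∈ U1 𝔸 := unitaryUnits_le_U1 (hW z κ)
  have hR : Rc (avgIter L U₀ j z κ) (vcov L U₀ (expCfg B) j (z + e κ)) ∈ U1 𝔸 :=
    unitaryUnits_le_U1 (Rc_mem_unitaryUnits (hV₀ z κ) (hv _))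
  have h3 := norm_mul₃_units_sub_one_le (c := (Rc (avgIter L U₀ j z κ) (vcov L U₀ (expCfg B) j (z + e κ)))⁻¹) ha hb'
  have hc : ‖(((Rc (avgIter L U₀ j z κ) (vcov L U₀ (expCfg B) j (z + e κ)))⁻¹ : 𝔸ˣ) : 𝔸) - 1‖
      ≤ 64 * (d : ℝ) * ((L : ℝ) ^ j * b) := by
    refine (norm_inv_sub_one_le hR).trans ?_
    rw [Rc_apply, Units.val_mul, Units.val_mul]
    exact (norm_units_conj_sub_one_le (unitaryUnits_le_U1 (hV₀ z κ)) _).trans (norm_vcov_sub_one_le hL hU₀ hα hα3 hα4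
      h52 hb hB hsmall hc₃ hsm hj _).1
  have h1 := (norm_vcov_sub_one_le hL hU₀ hα hα3 hα4 h52 hb hB hsmall hc₃ hsm hj z).1
  have h2 := norm_dbavgCovIter_sub_one_le hd hL hU₀ hBu hα hα3 hα4 h52 hb hB hsmall hc₃ hsm hαP hαP3 hαP2 hP hj z κ
  have hjb : 0 ≤ (L : ℝ) ^ j * b := by positivity
  nlinarith

include hd hL hU₀ hBu hα hα3 hα4 h52 hb hB hsmall hc₃ hsm hαP hαP3 hαP2 hP in
/-- **The twisted transports of `Ũ₁ʲ` along the block contours** (the factors `(R̄ʲ_{0,y}Ũ₁ʲ)(Γ_{y,x})` of (76)/(77)) are within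
`128dLʲb + 4dL^{j+1}b` of `1`, `j < k`: `(R̄ʲ_{0,y}Ũ₁ʲ)(Γ_{y,x}) = v_j(y)(R̄ʲ_{0,y}U̿₁ʲ)(Γ_{y,x})[R(Ū₀ʲ(Γ_{y,x}))v_j(x)]⁻¹`
(`B7Eq92Concrete.tHol_mgauge`), with (163) and the twist bound behind (162) (`B7Eq162General.norm_twist_general`).
[cite: Balaban1985Averaging, (76)–(77) pp.29–30, (159)–(163) p.42] -/
theorem norm_tHol_tildIter_sub_one_le {j : ℕ} (hj : j < k) (y : Site d) (r : Fin d → Fin L) :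
    ‖((tHol (avgIter L U₀ j) (tildIter L U₀ (expCfg B) j) ((L : ℤ) • y) (treeWord (boxVec L r)) : 𝔸ˣ) : 𝔸) - 1‖
      ≤ 128 * (d : ℝ) * ((L : ℝ) ^ j * b) + 4 * (d : ℝ) * ((L : ℝ) ^ (j + 1) * b) := by
  obtain ⟨hW, hv⟩ := dbavgCovIter_vcov_mem_unitaryUnits hd hL hU₀ hBu hα hα3 hα4 h52 hb hB hsmall hc₃ hsm hαP hαP3 hαP2 hP
    j hj.le
  have hV₀ := avgIter_mem_unitaryUnits hL hU₀ hα hα3 hα4 h52 j hj.le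
  rw [tildIter_eq_mgauge L U₀ (expCfg B) j, tHol_mgauge, disp_treeWord]
  have ha : vcov L U₀ (expCfg B) j ((L : ℤ) • y) ∈ U1 𝔸 := unitaryUnits_le_U1 (hv _)
  have hT : tHol (avgIter L U₀ j) (dbavgCovIter L U₀ (expCfg B) j) ((L : ℤ) • y) (treeWord (boxVec L r)) ∈ U1 𝔸 :=
    unitaryUnits_le_U1 (tHol_mem_unitaryUnits hV₀ hW _ _)
  have hh : hol (avgIter L U₀ j) ((L : ℤ) • y) (treeWord (boxVec L r)) ∈ unitaryUnits 𝔸 := hol_mem_of hV₀ _ _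
  have hR : Rc (hol (avgIter L U₀ j) ((L : ℤ) • y) (treeWord (boxVec L r)))
      (vcov L U₀ (expCfg B) j ((L : ℤ) • y + boxVec L r)) ∈ U1 𝔸 :=
    unitaryUnits_le_U1 (Rc_mem_unitaryUnits hh (hv _))
  have h3 := norm_mul₃_units_sub_one_le
    (c := (Rc (hol (avgIter L U₀ j) ((L : ℤ) • y) (treeWord (boxVec L r)))
      (vcov L U₀ (expCfg B) j ((L : ℤ) • y + boxVec L r)))⁻¹) ha hT
  have hc : ‖(((Rc (hol (avgIter L U₀ j) ((L : ℤ) • y) (treeWord (boxVec L r)))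
      (vcov L U₀ (expCfg B) j ((L : ℤ) • y + boxVec L r)))⁻¹ : 𝔸ˣ) : 𝔸) - 1‖ ≤ 64 * (d : ℝ) * ((L : ℝ) ^ j * b) := by
    refine (norm_inv_sub_one_le hR).trans ?_
    rw [Rc_apply, Units.val_mul, Units.val_mul]
    exact (norm_units_conj_sub_one_le (unitaryUnits_le_U1 hh) _).trans
      (norm_vcov_sub_one_le hL hU₀ hα hα3 hα4 h52 hb hB hsmall hc₃ hsm hj.le _).1
  have h1 := (norm_vcov_sub_one_le hL hU₀ hα hα3 hα4 h52 hb hB hsmall hc₃ hsm hj.le ((L : ℤ) • y)).1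
  have h2 := norm_twist_general hL (avgClosed_unitaryUnits d L) hU₀ hα hα3 hα4 h52 hb hB hsmall hc₃ hsm hj ((L : ℤ) • y)
    (l1_boxVec_le L r)
  linarith

include hd hL hU₀ hBu hα hα3 hα4 h52 hb hB hsmall hc₃ hsm hαP hαP3 hαP2 hP in
/-- **Print's gauge transformation `u` is within `200dLᵏb` of `1` at every level and every site**: telescoping the recursion
(76)/(77) (`B7Eq84Concrete.glev_of_lt`: `u_j(x) = R(Ū₀ʲ(Γ_{y,x}))⁻¹[u_{j+1}(y)(R̄ʲ_{0,y}Ũ₁ʲ)(Γ_{y,x})]`) from the top value (87)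
`u_k = v_k⁻¹` ((163): within `64dLᵏb`), each level costing `128dLʲb + 4dL^{j+1}b ≤ 68dL^{j+1}b` (`norm_tHol_tildIter_sub_one_le`), and
`Σ_{j<k} L^{j+1} ≤ 2Lᵏ` for `L ≥ 2` — the tree's form of [3] p. 44 *"all operations … are done always in a case where proper expressions
are small"* for the gauge fixing itself. [cite: Balaban1985Averaging, (76)–(77) pp.29–30, (87) p.31, (163) p.42] -/
theorem norm_glev_sub_one_le (hL1 : 1 ≤ L) :
    ∀ j ≤ k, ∀ x : Site d, ‖((glev L hL1 U₀ (expCfg B) k j x : 𝔸ˣ) : 𝔸) - 1‖ ≤ 200 * (d : ℝ) * ((L : ℝ) ^ k * b) := by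
  have hLr : (2 : ℝ) ≤ L := by exact_mod_cast hL
  have hd0 : (0 : ℝ) ≤ d := Nat.cast_nonneg d
  -- the sharper telescoped bound, by downward induction on the depth `m = k − j`
  suffices h : ∀ m j : ℕ, j + m = k → ∀ x : Site d,
      ‖((glev L hL1 U₀ (expCfg B) k j x : 𝔸ˣ) : 𝔸) - 1‖
        ≤ 64 * (d : ℝ) * ((L : ℝ) ^ k * b) + 68 * (d : ℝ) * b * (((L : ℝ) ^ (k + 1) - (L : ℝ) ^ (j + 1)) / ((L : ℝ) - 1)) by
    intro j hj x
    refine (h (k - j) j (by omega) x).trans ?_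
    have hL1r : (0 : ℝ) < (L : ℝ) - 1 := by linarith
    have hgeo : ((L : ℝ) ^ (k + 1) - (L : ℝ) ^ (j + 1)) / ((L : ℝ) - 1) ≤ 2 * (L : ℝ) ^ k := by
      rw [div_le_iff₀ hL1r]
      have : (0 : ℝ) ≤ (L : ℝ) ^ (j + 1) := by positivity
      have hk : (L : ℝ) ^ (k + 1) = (L : ℝ) ^ k * L := pow_succ _ _
      nlinarith [pow_nonneg (show (0:ℝ) ≤ L by linarith) k]
    have : 68 * (d : ℝ) * b * (((L : ℝ) ^ (k + 1) - (L : ℝ) ^ (j + 1)) / ((L : ℝ) - 1)) ≤ 68 * (d : ℝ) * b * (2 * (L : ℝ) ^ k) :=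
      mul_le_mul_of_nonneg_left hgeo (by positivity)
    nlinarith
  intro m
  induction m with
  | zero =>
    intro j hjk x
    have hj : j = k := by omega
    subst hj
    rw [glev_top, wrec_eq_vcov, sub_self, zero_div, mul_zero, add_zero]
    exact (norm_vcov_sub_one_le hL hU₀ hα hα3 hα4 h52 hb hB hsmall hc₃ hsm le_rfl x).2
  | succ m ih =>
    intro j hjm x
    have hjk : j < k := by omega
    have hV₀ := avgIter_mem_unitaryUnits hL hU₀ hα hα3 hα4 h52 j hjk.le
    have hih := ih (j + 1) (by omega) (fl L x)
    have hT := norm_tHol_tildIter_sub_one_le hd hL hU₀ hBu hα hα3 hα4 h52 hb hB hsmall hc₃ hsm hαP hαP3 hαP2 hP hjk (fl L x)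
      (brem L hL1 x)
    have hg : glev L hL1 U₀ (expCfg B) k (j + 1) (fl L x) ∈ U1 𝔸 :=
      unitaryUnits_le_U1 (glev_mem_unitaryUnits hd hL hU₀ hBu hα hα3 hα4 h52 hb hB hsmall hc₃ hsm hαP hαP3 hαP2 hP hL1
        (j + 1) (by omega) _)
    have hh : hol (avgIter L U₀ j) ((L : ℤ) • fl L x) (treeWord (boxVec L (brem L hL1 x))) ∈ U1 𝔸 :=
      unitaryUnits_le_U1 (hol_mem_of hV₀ _ _)
    rw [glev_of_lt L hL1 U₀ (expCfg B) hjk, Rc_apply, Units.val_mul, Units.val_mul]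
    refine (norm_units_conj_sub_one_le ((U1 𝔸).inv_mem hh) _).trans ?_
    refine (B8Lemma1NonAbelian.norm_units_mul_sub_one_le hg).trans ?_
    -- arithmetic: `128dLʲb + 4dL^{j+1}b ≤ 68dL^{j+1}b = 68db·(L^{j+2} − L^{j+1})/(L − 1)`
    have hL1r : (0 : ℝ) < (L : ℝ) - 1 := by linarith
    have hstep : 68 * (d : ℝ) * b * (((L : ℝ) ^ (k + 1) - (L : ℝ) ^ (j + 1 + 1)) / ((L : ℝ) - 1))
        + 68 * (d : ℝ) * ((L : ℝ) ^ (j + 1) * b)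
          = 68 * (d : ℝ) * b * (((L : ℝ) ^ (k + 1) - (L : ℝ) ^ (j + 1)) / ((L : ℝ) - 1)) := by
      have e : (L : ℝ) ^ (j + 1 + 1) = (L : ℝ) ^ (j + 1) * L := pow_succ _ _
      rw [e]
      field_simp
      ring
    have hpow : (L : ℝ) ^ (j + 1) = (L : ℝ) ^ j * L := pow_succ _ _
    have hjb : 0 ≤ (L : ℝ) ^ j * b := by positivity
    have hlev : 128 * (d : ℝ) * ((L : ℝ) ^ j * b) + 4 * (d : ℝ) * ((L : ℝ) ^ (j + 1) * b)
        ≤ 68 * (d : ℝ) * ((L : ℝ) ^ (j + 1) * b) := by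
      rw [hpow]
      nlinarith [mul_nonneg (mul_nonneg hd0 hjb) (sub_nonneg.2 hLr), hd0, hjb]
    linarith

include hd hL hU₀ hBu hα hα3 hα4 h52 hb hB hsmall hc₃ hsm hαP hαP3 hαP2 hP in
/-- **`Ũ′ʲ = ((U′U₀)‾ʲ)(Ū₀ʲ)⁻¹` is within `530dLᵏb` of `1` at EVERY bond of EVERY level `j ≤ k`** for `U′ = U₁^{u}`, `u = glev`:
(70)/(71) `(Ũ′ʲ)_b = u_j(b₋)(Ũ₁ʲ)_b R̄ʲ_{0,b}u_j⁻¹(b₊)` (`B7Eq92Concrete.tildIter_mgauge`, `B7Eq84Concrete.uLev_glev`) with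
`norm_glev_sub_one_le` and `norm_tildIter_sub_one_le`. [cite: Balaban1985RegularSpaces, (1.30) p.81, (1.145) p.100; Balaban1985Averaging, (70)–(71) p.29] -/
theorem norm_tildIter_fixed_sub_one_le (hL1 : 1 ≤ L) {j : ℕ} (hj : j ≤ k) (z : Site d) (κ : Fin d) :
    ‖((tildIter L U₀ (mgauge U₀ (glev L hL1 U₀ (expCfg B) k 0) (expCfg B)) j z κ : 𝔸ˣ) : 𝔸) - 1‖
      ≤ 530 * (d : ℝ) * ((L : ℝ) ^ k * b) := by
  have hd1 : (1 : ℝ) ≤ d := by exact_mod_cast hd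
  have hV₀ := avgIter_mem_unitaryUnits hL hU₀ hα hα3 hα4 h52 j hj
  have hg := glev_mem_unitaryUnits hd hL hU₀ hBu hα hα3 hα4 h52 hb hB hsmall hc₃ hsm hαP hαP3 hαP2 hP hL1 j hj
  have hgn := norm_glev_sub_one_le hd hL hU₀ hBu hα hα3 hα4 h52 hb hB hsmall hc₃ hsm hαP hαP3 hαP2 hP hL1 j hj
  rw [tildIter_mgauge, mgauge_apply, uLev_glev L hL1 U₀ (expCfg B) k j hj]
  have ha : glev L hL1 U₀ (expCfg B) k j z ∈ U1 𝔸 := unitaryUnits_le_U1 (hg z)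
  have hb' : tildIter L U₀ (expCfg B) j z κ ∈ U1 𝔸 := by
    rw [tildIter_apply]
    exact unitaryUnits_le_U1 ((unitaryUnits 𝔸).mul_mem
      (avgIter_mul_mem_unitaryUnits hL hU₀ hBu hαP hαP3 hαP2 hP j hj z κ) ((unitaryUnits 𝔸).inv_mem (hV₀ z κ)))
  have hR : Rc (avgIter L U₀ j z κ) (glev L hL1 U₀ (expCfg B) k j (z + e κ)) ∈ U1 𝔸 :=
    unitaryUnits_le_U1 (Rc_mem_unitaryUnits (hV₀ z κ) (hg _))
  have h3 := norm_mul₃_units_sub_one_le (c := (Rc (avgIter L U₀ j z κ) (glev L hL1 U₀ (expCfg B) k j (z + e κ)))⁻¹) ha hb'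
  have hc : ‖(((Rc (avgIter L U₀ j z κ) (glev L hL1 U₀ (expCfg B) k j (z + e κ)))⁻¹ : 𝔸ˣ) : 𝔸) - 1‖
      ≤ 200 * (d : ℝ) * ((L : ℝ) ^ k * b) := by
    refine (norm_inv_sub_one_le hR).trans ?_
    rw [Rc_apply, Units.val_mul, Units.val_mul]
    exact (norm_units_conj_sub_one_le (unitaryUnits_le_U1 (hV₀ z κ)) _).trans (hgn _)
  have h1 := hgn z
  have h2 := norm_tildIter_sub_one_le hd hL hU₀ hBu hα hα3 hα4 h52 hb hB hsmall hc₃ hsm hαP hαP3 hαP2 hP hj z κ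
  have hmono := mul_le_mul_of_nonneg_left (level_mono hd hL hb hsm hj).1 (by positivity : (0 : ℝ) ≤ 130 * (d : ℝ))
  linarith

include hd hL hU₀ hBu hα hα3 hα4 h52 hb hB hsmall hc₃ hsm hαP hαP3 hαP2 hP in
/-- **(1.145), the INEQUALITY, on the printed domain «Ω_j^{(j)}» at EVERY level `j ≤ k`, for `U′ = U₁^{u}` with print's `u`**:
`|(U′U₀)‾ʲ_b − (Ū₀ʲ)_b| ≤ 530dLᵏb` at every bond `b` of `T^{(j)}` ((69): `(U′U₀)‾ʲ_b − (Ū₀ʲ)_b = (Ũ′ʲ_b − 1)(Ū₀ʲ)_b`, `(Ū₀ʲ)_b` unitary).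
[cite: Balaban1985RegularSpaces, (1.145) p.100, (1.20) p.79; Balaban1985Averaging, (69) p.29] -/
theorem norm_avgIter_fixed_sub_le_all (hL1 : 1 ≤ L) {j : ℕ} (hj : j ≤ k) (z : Site d) (κ : Fin d) :
    ‖((avgIter L (mgauge U₀ (glev L hL1 U₀ (expCfg B) k 0) (expCfg B) * U₀) j z κ : 𝔸ˣ) : 𝔸)
        - ((avgIter L U₀ j z κ : 𝔸ˣ) : 𝔸)‖ ≤ 530 * (d : ℝ) * ((L : ℝ) ^ k * b) := by
  have e : avgIter L (mgauge U₀ (glev L hL1 U₀ (expCfg B) k 0) (expCfg B) * U₀) j z κ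
      = tildIter L U₀ (mgauge U₀ (glev L hL1 U₀ (expCfg B) k 0) (expCfg B)) j z κ * avgIter L U₀ j z κ := by
    rw [← tildIter_mul]; rfl
  rw [e, Units.val_mul]
  have hY : ‖((avgIter L U₀ j z κ : 𝔸ˣ) : 𝔸)‖ ≤ 1 :=
    (unitaryUnits_le_U1 (avgIter_mem_unitaryUnits hL hU₀ hα hα3 hα4 h52 j hj z κ)).1
  have hX := norm_tildIter_fixed_sub_one_le hd hL hU₀ hBu hα hα3 hα4 h52 hb hB hsmall hc₃ hsm hαP hαP3 hαP2 hP hL1 hj z κ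
  have key : ((tildIter L U₀ (mgauge U₀ (glev L hL1 U₀ (expCfg B) k 0) (expCfg B)) j z κ : 𝔸ˣ) : 𝔸)
        * ((avgIter L U₀ j z κ : 𝔸ˣ) : 𝔸) - ((avgIter L U₀ j z κ : 𝔸ˣ) : 𝔸)
      = (((tildIter L U₀ (mgauge U₀ (glev L hL1 U₀ (expCfg B) k 0) (expCfg B)) j z κ : 𝔸ˣ) : 𝔸) - 1)
        * ((avgIter L U₀ j z κ : 𝔸ˣ) : 𝔸) := by
    noncomm_ring
  rw [key]
  calc _ ≤ ‖((tildIter L U₀ (mgauge U₀ (glev L hL1 U₀ (expCfg B) k 0) (expCfg B)) j z κ : 𝔸ˣ) : 𝔸) - 1‖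
          * ‖((avgIter L U₀ j z κ : 𝔸ˣ) : 𝔸)‖ := norm_mul_le _ _
    _ ≤ 530 * (d : ℝ) * ((L : ℝ) ^ k * b) * 1 := mul_le_mul hX hY (norm_nonneg _) (by positivity)
    _ = _ := mul_one _

end AllLevels

/-! ## §4 The lineage family packaged as `B8SectGH.GFData3`, and Proposition 7 for it -/

section Model

open Complex (I)

/-- «for α₀, α₂ sufficiently small»: the explicit threshold `c = c(d, L) > 0` of this file — the minimum of the windows of the inputs
used ((1.144): `1/(80d)` of `B8Ineq1144ClassAk`; Prop. 2 of [3]: `1/(24C₀(d))`, `c₂′(d,L)/16`; Prop. 4 of [3] @gen: `1/(32000(d+1)²(d+4))`,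
`1/(2²¹(d+1)²)`, `c₃(d,L)/2`; (162) @gen: `1/(2048d)`). [cite: Balaban1985RegularSpaces, Prop. 7 p.100 («for α₀, α₂ sufficiently small»)] -/
def cst (d L : ℕ) : ℝ :=
  min (1 / (80 * (d : ℝ))) (min (1 / (24 * C0 d)) (min (c2' d L / 16) (min (1 / (32000 * ((d : ℝ) + 1) ^ 2 * ((d : ℝ) + 4)))
    (min (1 / (2097152 * ((d : ℝ) + 1) ^ 2)) (min (c3 d L / 2) (1 / (2048 * (d : ℝ))))))))

/-- `c(d, L) > 0` for `d ≥ 1` («for α₀, α₂ sufficiently small» is a non-void condition).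
[cite: Balaban1985RegularSpaces, Prop. 7 p.100 («for α₀, α₂ sufficiently small»)] -/
theorem cst_pos (hd : 1 ≤ d) (L : ℕ) (hL : 1 ≤ L) : 0 < cst d L := by
  have hd' : (0 : ℝ) < d := by exact_mod_cast hd
  have hC0 := C0_pos d
  have hc2 : 0 < c2' d L := by unfold c2'; positivity
  have hc3 : 0 < c3 d L := by
    have : (0 : ℝ) < L := by exact_mod_cast hL
    unfold c3; positivity
  unfold cst
  refine lt_min (by positivity) (lt_min (by positivity) (lt_min (by positivity) (lt_min (by positivity)
    (lt_min (by positivity) (lt_min (by positivity) (by positivity))))))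

/-- What `α ≤ c(d, L)` gives. [folklore] -/
private theorem cst_facts {L : ℕ} {α : ℝ} (hαc : α ≤ cst d L) :
    α ≤ 1 / (80 * (d : ℝ)) ∧ α ≤ 1 / (24 * C0 d) ∧ α ≤ c2' d L / 16 ∧
      α ≤ 1 / (32000 * ((d : ℝ) + 1) ^ 2 * ((d : ℝ) + 4)) ∧ α ≤ 1 / (2097152 * ((d : ℝ) + 1) ^ 2) ∧
        α ≤ c3 d L / 2 ∧ α ≤ 1 / (2048 * (d : ℝ)) := by
  unfold cst at hαc
  simp only [le_min_iff] at hαc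
  obtain ⟨h1, h2, h3, h4, h5, h6, h7⟩ := hαc
  exact ⟨h1, h2, h3, h4, h5, h6, h7⟩

variable (d) in
/-- **The lineage family for Proposition 7, packaged as pv17's `B8SectGH.GFData3`** (so that the hypothesis on `A` is the printed pair
(1.139)/(1.140), all three members): index `i = (k, η)` — number of steps and lattice spacing —, for fixed dimension `d`, block size
`L` and C⋆-algebra `𝔸` (print: `M_N(ℂ) ⊃ U(N) ⊃ G`); the admissible family is print's admitted case «Ω_j = T_η, j = 0, 1, …, l» (p. 77)
at `l = k`, so `Λ_k = T^{(k)}`, `Λ_j = ∅` (`j < k`), `𝔅_k = Λ_k` (`LamTop`).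
* `Cfg` = the `G`-valued gauge field configurations on `T_η ↦ ℤᵈ` (`G = U(𝔸)`, `B7Prop2Explicit.unitaryUnits`); `Pert` = configurations
  `U₁`/`U′` (units of `𝔸`; the hypothesis `C140` pins `U₁ = e^{iηA}`); `GT` = gauge transformations; `Src = Unit` (Thm 8 only).
* `InA α U₀` = (1.139)/(1.33) «U₀ ∈ 𝔄_k({Ω_j}, α)» = `B8Ineq132.InAk` over `Ω_j = T`;
  `C140 α₂ U₀ U₁` = «U₁ = e^{iηA}», `A` Lie-algebra (Hermitian) valued, with (1.140) «Lʲη|A|, (Lʲη)²|∇^η_{U₀}A|, (Lʲη)³|D^{η*}_{U₀}D^η_{U₀}A| < α₂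
  on Ω_j», `j ≤ k`, ALL THREE members (componentwise covariant gradient `B8Ineq132.covDerivFwd`, and `D^{η*}_{U₀}D^η_{U₀}A =
  B8Eq143PlaqExpansion.pdiv ∘ B8Eq146AExpansion.plaqCovDeriv`, the readings of the (1.141)/(1.142) certificates);
  `InAAx α U₀ U′` = (1.144)/(1.34) «U′U₀ ∈ 𝔄_k({Ω_j}, α) ∩ Ax_k(𝔅_k, U₀)» (`InAk ∧ B8Eq119TwistedAxial.InAx`);
  `avgClose α U₀ U′` = (1.35) «|(U′U₀)‾ʲ − Ū₀ʲ| < α on Λ_j» (bond convention p. 77), through which `Prop7PrintedR`/`Prop7RepairedC` read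
  (1.145) (pv17 DIVERGENCE D-pv17.4); `avgClose166` = (1.66); `Restricted` = (1.29) `B8Eq119TwistedAxial.Restr129`; `C162 B s` = (1.41)-shape
  first member only; `InAPair` = (1.40) pair.
* The fields of Theorems 2/4/8 and Props. 3/5/6 that Proposition 7 does not read ((1.36)–(1.39), (1.62), (1.146), (3.35), `act`,
  `fNorm`, `fGrad`, `InR`) are not modelled on these carriers and are set to trivial data (`True`/`0`/the (1.18)-action at `U₀ = 1`),
  exactly as in r05 g6's `B8Ineq145Lineage.lineageGF7`.
[cite: Balaban1985RegularSpaces, (1.139)–(1.140) p.100, (1.144)–(1.145) p.100, (1.33)–(1.35) p.82, (1.29) p.81, (1.5) p.77, p.77 («Ω_j = T_η»)] -/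
def admittedGF (L : ℕ) (𝔸 : Type) [CStarAlgebra 𝔸] (i : ℕ × {η : ℝ // 0 < η}) : B8SectGH.GFData3 where
  Cfg := {U : Site d → Fin d → 𝔸ˣ // ∀ x κ, U x κ ∈ unitaryUnits 𝔸}
  Pert := Site d → Fin d → 𝔸ˣ
  GT := Site d → 𝔸ˣ
  Src := Unit
  k := i.1
  InA := fun α U₀ => InAk L i.1 (i.2 : ℝ) α (fun _ => Set.univ) U₀.1
  Reg335 := fun _ _ => True
  InAAx := fun α U₀ U' =>
    InAk L i.1 (i.2 : ℝ) α (fun _ => Set.univ) (U' * U₀.1) ∧ InAx L i.1 (LamTop i.1) U₀.1 (U' * U₀.1)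
  avgClose := fun α U₀ U' => ∀ j, j ≤ i.1 → ∀ (z : Site d) (κ : Fin d), BondTouches (LamTop i.1 j) z κ →
    ‖((avgIter L (U' * U₀.1) j z κ : 𝔸ˣ) : 𝔸) - ((avgIter L U₀.1 j z κ : 𝔸ˣ) : 𝔸)‖ < α
  avgClose166 := fun α U₀ U' => ∀ j, j ≤ i.1 → ∀ (z : Site d) (κ : Fin d),
    ‖((tildIter L U₀.1 U' j z κ : 𝔸ˣ) : 𝔸) - 1‖ < α
  Restricted := fun U₀ u => Restr129 L i.1 (LamTop i.1) U₀.1 u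
  act := fun U' u => gaugeAct (fun x => (u x)⁻¹) U'
  C136 := fun _ _ _ _ _ => True
  C137 := fun _ _ _ => True
  Landau := fun _ _ => True
  C139 := fun _ _ _ _ => True
  C162 := fun Bc s _ U₁ => ∃ A : Site d → Fin d → 𝔸, (∀ y κ, IsSelfAdjoint (A y κ)) ∧ U₁ = expCfg (iEta (i.2 : ℝ) A) ∧
    ∀ j, j ≤ i.1 → ∀ (y : Site d) (κ : Fin d), (L : ℝ) ^ j * (i.2 : ℝ) * ‖A y κ‖ < Bc * s
  fNorm := fun _ => 0
  LandauF := fun _ _ _ => True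
  InAPair := fun α U₀ U₁ =>
    InAk L i.1 (i.2 : ℝ) α (fun _ => Set.univ) U₀.1 ∧ InAk L i.1 (i.2 : ℝ) α (fun _ => Set.univ) (U₁ * U₀.1)
  fGrad := fun _ _ => 0
  C140 := fun α₂ U₀ U₁ => ∃ A : Site d → Fin d → 𝔸, (∀ y κ, IsSelfAdjoint (A y κ)) ∧ U₁ = expCfg (iEta (i.2 : ℝ) A) ∧
    ∀ j, j ≤ i.1 → ∀ (y : Site d) (κ : Fin d),
      (L : ℝ) ^ j * (i.2 : ℝ) * ‖A y κ‖ < α₂ ∧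
      (∀ τ : Fin d, ((L : ℝ) ^ j * (i.2 : ℝ)) ^ 2 * ‖covDerivFwd (i.2 : ℝ) U₀.1 κ (fun z => A z τ) y‖ < α₂) ∧
      ((L : ℝ) ^ j * (i.2 : ℝ)) ^ 3 * ‖pdiv (i.2 : ℝ) U₀.1 (plaqCovDeriv (i.2 : ℝ) U₀.1 A) κ y‖ < α₂
  InR := fun _ _ => True

variable (d) in
/-- **`U₁ ↦ U′ = U₁^{u}`, the axial representative of (1.144)**, with print's gauge transformation `u` — the one satisfying (1.29) and
putting `U′U₀ = (U₁U₀)^u` into `Ax_k(𝔅_k, U₀)` (p. 100: *"Let us take a gauge transformation u satisfying the conditions (1.29) and such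
that the configuration U′ = (U₁U₀)^u U₀⁻¹ satisfies the axial gauge conditions (1.19). This gauge transformation is determined
uniquely."*): for the admitted family this is the gauge fixing (77) + (87) of [3], `B7Eq84Concrete.glev … k 0` (`restr129_glev`,
`inAx_glev`; uniqueness `B7Eq84Concrete.gaugeFixing_unique`), acting in the moving frame (55) = (1.17).
[cite: Balaban1985RegularSpaces, (1.144) p.100, (1.29) p.81, (1.19) p.79, (1.17) p.78; Balaban1985Averaging, (77) p.30, (87) p.31, (55) p.27] -/
def toAxialGF (L : ℕ) (hL1 : 1 ≤ L) (𝔸 : Type) [CStarAlgebra 𝔸] :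
    ∀ i : ℕ × {η : ℝ // 0 < η}, (admittedGF d L 𝔸 i).Cfg → (admittedGF d L 𝔸 i).Pert → (admittedGF d L 𝔸 i).Pert :=
  fun i U₀ U₁ => mgauge U₀.1 (glev L hL1 U₀.1 U₁ i.1 0) U₁

variable {𝔸 : Type} [CStarAlgebra 𝔸] [Nontrivial 𝔸]

/-- `Real.exp (1/5) · (3/2) ≤ 2`. [folklore] -/
private theorem exp_fifth_mul_le : Real.exp (1 / 5) * (1 + 1 / 2) ≤ 2 := by
  have := B7Eq31BCH.exp_one_fifth_le
  nlinarith [Real.exp_pos (1 / 5 : ℝ)]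

/-- THE STANDING DATA of §1/§3 produced from the hypotheses of Proposition 7 for the admitted family: `B = iηA` with
`sup|B| ≤ b = ηα₂(Lᵏη)⁻¹` (`Lᵏb = α₂`), `U₁ = e^{iηA}` unitary-valued, the Prop.-2/Prop.-4 windows of [3] at `2α₀` (for `U₀`: (1.139)
summed up, `B8Ineq1144TwistedAxial.pdev_le_of_forall`) and at `2(α₀ + 3α₂)` (for `U₁U₀`: (1.141) summed up, `pdev_mulCfg_le`), all from
`0 < α₀, α₂ ≤ c(d, L)`. [cite: Balaban1985RegularSpaces, (1.139)–(1.141) p.100; Balaban1985Averaging, (52) p.26] -/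
private theorem standing (hd : 1 ≤ d) {L : ℕ} (hL : 2 ≤ L) (hL1 : 1 ≤ L) (k : ℕ) {η : ℝ} (hη : 0 < η)
    {α₀ α₂ : ℝ} (hα₀ : 0 < α₀) (hα₀c : α₀ ≤ cst d L) (hα₂ : 0 < α₂) (hα₂c : α₂ ≤ cst d L)
    {U₀ : Site d → Fin d → 𝔸ˣ} (hU₀ : ∀ x κ, U₀ x κ ∈ unitaryUnits 𝔸) (h139 : InAk L k η α₀ (fun _ => Set.univ) U₀)
    {A : Site d → Fin d → 𝔸} (hAh : ∀ y κ, IsSelfAdjoint (A y κ))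
    (hA : ∀ y κ, ‖A y κ‖ ≤ α₂ * ((L : ℝ) ^ k * η)⁻¹)
    (hG : ∀ (y : Site d) (κ τ : Fin d), ‖covDerivFwd η U₀ κ (fun z => A z τ) y‖ ≤ α₂ * (((L : ℝ) ^ k * η)⁻¹) ^ 2) :
    (L : ℝ) ^ k * (η * (α₂ * ((L : ℝ) ^ k * η)⁻¹)) = α₂ ∧ 0 ≤ η * (α₂ * ((L : ℝ) ^ k * η)⁻¹) ∧
    (∀ x κ, ‖iEta η A x κ‖ ≤ η * (α₂ * ((L : ℝ) ^ k * η)⁻¹)) ∧ (∀ x κ, expCfg (iEta η A) x κ ∈ unitaryUnits 𝔸) ∧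
    0 < 2 * α₀ ∧ C0 d * (2 * α₀) ≤ 1 / 3 ∧ 4 * (2 * α₀) ≤ c2' d L ∧ pdev U₀ < 2 * α₀ * (((L : ℝ) ^ k)⁻¹) ^ 2 ∧
    Real.exp (4 * (800 * ((d : ℝ) + 1) ^ 2 * ((d : ℝ) + 4)) * (2 * α₀))
      * (1 + 8 * (131072 * ((d : ℝ) + 1) ^ 2) * ((L : ℝ) ^ k * (η * (α₂ * ((L : ℝ) ^ k * η)⁻¹)))) ≤ 2 ∧
    2 * ((L : ℝ) ^ k * (η * (α₂ * ((L : ℝ) ^ k * η)⁻¹))) ≤ c3 d L ∧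
    2048 * (d : ℝ) * ((L : ℝ) ^ k * (η * (α₂ * ((L : ℝ) ^ k * η)⁻¹))) ≤ 1 ∧
    0 < 2 * (α₀ + 3 * α₂) ∧ C0 d * (2 * (α₀ + 3 * α₂)) ≤ 1 / 3 ∧ 2 * (2 * (α₀ + 3 * α₂)) ≤ c2' d L ∧
    pdev (expCfg (iEta η A) * U₀) < 2 * (α₀ + 3 * α₂) * (((L : ℝ) ^ k)⁻¹) ^ 2 ∧
    α₀ ≤ 1 / (80 * (d : ℝ)) ∧ α₂ ≤ 1 / (80 * (d : ℝ)) := by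
  -- the windows
  obtain ⟨h80₀, h24₀, hc2₀, h32₀, -, -, -⟩ := cst_facts hα₀c
  obtain ⟨h80₂, h24₂, hc2₂, -, h21₂, hc3₂, h2048₂⟩ := cst_facts hα₂c
  have hd' : (1 : ℝ) ≤ d := by exact_mod_cast hd
  have hC0 := C0_pos d
  have hc2 : 0 < c2' d L := by unfold c2'; positivity
  have hL0 : (L : ℝ) ≠ 0 := by
    have : (0 : ℝ) < L := by exact_mod_cast (lt_of_lt_of_le (by norm_num) hL1)
    exact this.ne'
  have hη0 : η ≠ 0 := hη.ne'
  set b : ℝ := η * (α₂ * ((L : ℝ) ^ k * η)⁻¹) with hbdef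
  have hscale : (L : ℝ) ^ k * b = α₂ := by rw [hbdef]; field_simp
  have hb : 0 ≤ b := by positivity
  have hBn : ∀ x κ, ‖iEta η A x κ‖ ≤ b := norm_iEta_le hη.le hA
  have hBu : ∀ x κ, expCfg (iEta η A) x κ ∈ unitaryUnits 𝔸 := expCfg_iEta_mem_unitaryUnits η hAh
  have h₀ : ∀ y κ, U₀ y κ ∈ U1 𝔸 := fun y κ => unitaryUnits_le_U1 (hU₀ y κ)
  have h₁ : ∀ y κ, B8Eq146AExpansion.expCfg (iEta η A) y κ ∈ U1 𝔸 := expCfg_iEta_mem_U1 η hAh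
  have hu : ∀ y κ, ‖(B8Eq146AExpansion.expCfg (iEta η A) y κ : 𝔸) - 1‖ ≤ α₂ * ((L : ℝ) ^ k * η)⁻¹ * η :=
    norm_expCfg_iEta_sub_one_le_of_141 hη.le hAh hA
  obtain ⟨h7, -⟩ := forall_of_inAk_univ h139
  -- (52) for `U₀` with `2α₀` (the pointwise STRICT (1.7) gives `sup ≤ α₀L^{−2k} < 2α₀L^{−2k}`)
  have hLk : (0 : ℝ) < (((L : ℝ) ^ k)⁻¹) ^ 2 := by positivity
  have h52 : pdev U₀ < 2 * α₀ * (((L : ℝ) ^ k)⁻¹) ^ 2 := by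
    have hle : pdev U₀ ≤ α₀ * (((L : ℝ) ^ k)⁻¹) ^ 2 :=
      pdev_le_of_forall (by positivity) fun x κ ν hκν => (h7 x κ ν hκν).le
    nlinarith
  -- (52) for `U₁U₀` with `αP = 2(α₀ + 3α₂)` ((1.141) summed up, `B8Ineq1144TwistedAxial.pdev_mulCfg_le`)
  have h80d : (1 : ℝ) / (80 * d) ≤ 1 / 80 := by
    rw [div_le_div_iff₀ (by positivity) (by norm_num)]; nlinarith
  have hP : pdev (expCfg (iEta η A) * U₀) < 2 * (α₀ + 3 * α₂) * (((L : ℝ) ^ k)⁻¹) ^ 2 := by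
    have hle : pdev (mulCfg (B8Eq146AExpansion.expCfg (iEta η A)) U₀) ≤ (α₀ + 3 * α₂) * (((L : ℝ) ^ k)⁻¹) ^ 2 :=
      pdev_mulCfg_le hη h₀ h₁ hL1 hα₀.le (by linarith) hα₂.le (by linarith) hu hA hG h7
    have hmul : mulCfg (B8Eq146AExpansion.expCfg (iEta η A)) U₀ = expCfg (iEta η A) * U₀ := rfl
    rw [hmul] at hle
    have : 0 < (α₀ + 3 * α₂) * (((L : ℝ) ^ k)⁻¹) ^ 2 := by positivity
    linarith
  -- the Prop.-2 / Prop.-4 windows at `2α₀`, `αP`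
  have e24 : C0 d * (1 / (24 * C0 d)) = 1 / 24 := by field_simp
  have hC₀ : C0 d * α₀ ≤ 1 / 24 := (mul_le_mul_of_nonneg_left h24₀ hC0.le).trans_eq e24
  have hC₂ : C0 d * α₂ ≤ 1 / 24 := (mul_le_mul_of_nonneg_left h24₂ hC0.le).trans_eq e24
  have hd41 : (0 : ℝ) < ((d : ℝ) + 1) ^ 2 * ((d : ℝ) + 4) := by positivity
  have hd1' : (0 : ℝ) < ((d : ℝ) + 1) ^ 2 := by positivity
  have hsmall : Real.exp (4 * (800 * ((d : ℝ) + 1) ^ 2 * ((d : ℝ) + 4)) * (2 * α₀))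
      * (1 + 8 * (131072 * ((d : ℝ) + 1) ^ 2) * ((L : ℝ) ^ k * b)) ≤ 2 := by
    rw [hscale]
    have e5 : (6400 * (((d : ℝ) + 1) ^ 2 * ((d : ℝ) + 4))) * (1 / (32000 * ((d : ℝ) + 1) ^ 2 * ((d : ℝ) + 4)))
        = 1 / 5 := by
      field_simp; ring
    have hx : 4 * (800 * ((d : ℝ) + 1) ^ 2 * ((d : ℝ) + 4)) * (2 * α₀) ≤ 1 / 5 := by
      have h := (mul_le_mul_of_nonneg_left h32₀ (by positivity :
        (0 : ℝ) ≤ 6400 * (((d : ℝ) + 1) ^ 2 * ((d : ℝ) + 4)))).trans_eq e5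
      have : 4 * (800 * ((d : ℝ) + 1) ^ 2 * ((d : ℝ) + 4)) * (2 * α₀)
          = (6400 * (((d : ℝ) + 1) ^ 2 * ((d : ℝ) + 4))) * α₀ := by ring
      rw [this]; exact h
    have e2 : (1048576 * ((d : ℝ) + 1) ^ 2) * (1 / (2097152 * ((d : ℝ) + 1) ^ 2)) = 1 / 2 := by
      field_simp; ring
    have hy : 8 * (131072 * ((d : ℝ) + 1) ^ 2) * α₂ ≤ 1 / 2 := by
      have h := (mul_le_mul_of_nonneg_left h21₂ (by positivity : (0 : ℝ) ≤ 1048576 * ((d : ℝ) + 1) ^ 2)).trans_eq e2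
      have : 8 * (131072 * ((d : ℝ) + 1) ^ 2) * α₂ = (1048576 * ((d : ℝ) + 1) ^ 2) * α₂ := by ring
      rw [this]; exact h
    have hy0 : 0 ≤ 8 * (131072 * ((d : ℝ) + 1) ^ 2) * α₂ := by positivity
    calc _ ≤ Real.exp (1 / 5) * (1 + 1 / 2) := by
          gcongr
      _ ≤ 2 := exp_fifth_mul_le
  have hc₃ : 2 * ((L : ℝ) ^ k * b) ≤ c3 d L := by rw [hscale]; linarith
  have hsm : 2048 * (d : ℝ) * ((L : ℝ) ^ k * b) ≤ 1 := by
    rw [hscale]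
    have hd0 : (0 : ℝ) < d := by exact_mod_cast hd
    have e1 : (2048 * (d : ℝ)) * (1 / (2048 * (d : ℝ))) = 1 := by field_simp
    exact (mul_le_mul_of_nonneg_left h2048₂ (by positivity : (0 : ℝ) ≤ 2048 * (d : ℝ))).trans_eq e1
  exact ⟨hscale, hb, hBn, hBu, by positivity, by linarith, by linarith, h52, hsmall, hc₃, hsm, by positivity, by linarith,
    by linarith, hP, h80₀, h80₂⟩

/-- **PROPOSITION 7 FOR THE ADMITTED FAMILY, all inputs explicit** — for `d ≥ 1`, `L ≥ 2`, every `k`, `η > 0`, `0 < α₀ ≤ c(d,L)`,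
`0 < α₂ ≤ c(d,L)`, every `U(𝔸)`-valued `U₀ ∈ 𝔄_k({T_η, …, T_η}, α₀)` ((1.139)) and every Hermitian `A` with (1.140) at the top level on
all bonds (`|A| ≤ α₂(Lᵏη)⁻¹`, `|∇^η_{U₀}A| ≤ α₂(Lᵏη)⁻²` componentwise, `|D^{η*}_{U₀}D^η_{U₀}A| ≤ α₂(Lᵏη)⁻³`), with `U₁ = e^{iηA}` and print's
`u = glev`: (i) `u` is `U(𝔸)`-valued; (ii) (1.144) «U′U₀ = (U₁U₀)^u ∈ 𝔄_k({Ω_j}, α₀ + 3α₂)» for EVERY family `{Ω_j}`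
(`B8Ineq1144ClassAk.inAk_mulCfg_gaugeAct_hermitian`); (iii) (1.144) «… ∩ Ax_k(𝔅_k, U₀)» (`inAx_glev`) and (1.29) (`restr129_glev`);
(iv) (1.145) ↦ (1.35) at level `k`: «|(U′U₀)‾ᵏ_b − (Ū₀ᵏ)_b| ≤ 2α₂» at EVERY bond `b` of `T^{(k)}` (`norm_avgIter_fixed_sub_le` with
`Lᵏb = α₂`, `b = ηα₂(Lᵏη)⁻¹`). [cite: Balaban1985RegularSpaces, Prop. 7 (1.144)–(1.145) p.100] -/
theorem prop7_admitted_explicit (hd : 1 ≤ d) {L : ℕ} (hL : 2 ≤ L) (hL1 : 1 ≤ L) (k : ℕ) {η : ℝ} (hη : 0 < η)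
    {α₀ α₂ : ℝ} (hα₀ : 0 < α₀) (hα₀c : α₀ ≤ cst d L) (hα₂ : 0 < α₂) (hα₂c : α₂ ≤ cst d L)
    {U₀ : Site d → Fin d → 𝔸ˣ} (hU₀ : ∀ x κ, U₀ x κ ∈ unitaryUnits 𝔸) (h139 : InAk L k η α₀ (fun _ => Set.univ) U₀)
    {A : Site d → Fin d → 𝔸} (hAh : ∀ y κ, IsSelfAdjoint (A y κ))
    (hA : ∀ y κ, ‖A y κ‖ ≤ α₂ * ((L : ℝ) ^ k * η)⁻¹)
    (hG : ∀ (y : Site d) (κ τ : Fin d), ‖covDerivFwd η U₀ κ (fun z => A z τ) y‖ ≤ α₂ * (((L : ℝ) ^ k * η)⁻¹) ^ 2)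
    (hDDA : ∀ (y : Site d) (κ : Fin d), ‖pdiv η U₀ (plaqCovDeriv η U₀ A) κ y‖ ≤ α₂ * (((L : ℝ) ^ k * η)⁻¹) ^ 3) :
    (∀ x, glev L hL1 U₀ (expCfg (iEta η A)) k 0 x ∈ unitaryUnits 𝔸) ∧
    (∀ Ω : ℕ → Set (Site d),
      InAk L k η (α₀ + 3 * α₂) Ω (mgauge U₀ (glev L hL1 U₀ (expCfg (iEta η A)) k 0) (expCfg (iEta η A)) * U₀)) ∧
    InAx L k (LamTop k) U₀ (mgauge U₀ (glev L hL1 U₀ (expCfg (iEta η A)) k 0) (expCfg (iEta η A)) * U₀) ∧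
    Restr129 L k (LamTop k) U₀ (glev L hL1 U₀ (expCfg (iEta η A)) k 0) ∧
    ∀ (z : Site d) (κ : Fin d),
      ‖((avgIter L (mgauge U₀ (glev L hL1 U₀ (expCfg (iEta η A)) k 0) (expCfg (iEta η A)) * U₀) k z κ : 𝔸ˣ) : 𝔸)
          - ((avgIter L U₀ k z κ : 𝔸ˣ) : 𝔸)‖ ≤ 2 * α₂ := by
  obtain ⟨hscale, hb, hBn, hBu, hα', hα3', hα4', h52, hsmall, hc₃, hsm, hαP, hαP3, hαP2, hP, h80₀, h80₂⟩ :=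
    standing hd hL hL1 k hη hα₀ hα₀c hα₂ hα₂c hU₀ h139 hAh hA hG
  have h₀ : ∀ y κ, U₀ y κ ∈ U1 𝔸 := fun y κ => unitaryUnits_le_U1 (hU₀ y κ)
  obtain ⟨h7, h9⟩ := forall_of_inAk_univ h139
  -- (i) `u` unitary-valued
  have hu1 : ∀ x, glev L hL1 U₀ (expCfg (iEta η A)) k 0 x ∈ unitaryUnits 𝔸 :=
    glev_mem_unitaryUnits hd hL hU₀ hBu hα' hα3' hα4' h52 hb hBn hsmall hc₃ hsm hαP hαP3 hαP2 hP hL1 0 (Nat.zero_le _)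
  refine ⟨hu1, fun Ω => ?_, inAx_glev L hL1 k U₀ (expCfg (iEta η A)), restr129_glev L hL1 k U₀ (expCfg (iEta η A)),
    fun z κ => ?_⟩
  · -- (ii) the `𝔄_k`-clause of (1.144) (p40's theorem, for the unitary-valued `u`)
    rw [mgauge_mul_eq_gaugeAct_mulCfg]
    exact inAk_mulCfg_gaugeAct_hermitian hη hL1 k h₀ hAh hα₀.le h80₀ hα₂.le h80₂ h7 h9 hA hG hDDA Ω
      (fun x => unitaryUnits_le_U1 (hu1 x))
  · -- (iv) (1.145)/(1.35) at level `k`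
    have h := norm_avgIter_fixed_sub_le hd hL hU₀ hBu hα' hα3' hα4' h52 hb hBn hsmall hc₃ hsm hαP hαP3 hαP2 hP hL1 z κ
    rwa [hscale] at h

/-- **(1.145), the INEQUALITY, on the printed domain «Ω_j^{(j)}» at EVERY level — admitted family, all inputs explicit**: under the
hypotheses of `prop7_admitted_explicit`, `|(U′U₀)‾ʲ_b − (Ū₀ʲ)_b| ≤ 530d·α₂` at every bond `b` of `T^{(j)}`, `j = 0, 1, …, k`
(`norm_avgIter_fixed_sub_le_all` with `Lᵏb = α₂`).  Print: `< 2α₂` with EQUALITY `= |exp iQ_j(U₀, ηA) − 1|`; the equality fails at the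
levels `j < k` on the tree bonds of the axial gauge (`B8Ineq145` (a)); the inequality survives with the `d`-dependent constant.
[cite: Balaban1985RegularSpaces, Prop. 7 (1.145) p.100] -/
theorem ineq145_allLevels_admitted_explicit (hd : 1 ≤ d) {L : ℕ} (hL : 2 ≤ L) (hL1 : 1 ≤ L) (k : ℕ) {η : ℝ} (hη : 0 < η)
    {α₀ α₂ : ℝ} (hα₀ : 0 < α₀) (hα₀c : α₀ ≤ cst d L) (hα₂ : 0 < α₂) (hα₂c : α₂ ≤ cst d L)
    {U₀ : Site d → Fin d → 𝔸ˣ} (hU₀ : ∀ x κ, U₀ x κ ∈ unitaryUnits 𝔸) (h139 : InAk L k η α₀ (fun _ => Set.univ) U₀)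
    {A : Site d → Fin d → 𝔸} (hAh : ∀ y κ, IsSelfAdjoint (A y κ))
    (hA : ∀ y κ, ‖A y κ‖ ≤ α₂ * ((L : ℝ) ^ k * η)⁻¹)
    (hG : ∀ (y : Site d) (κ τ : Fin d), ‖covDerivFwd η U₀ κ (fun z => A z τ) y‖ ≤ α₂ * (((L : ℝ) ^ k * η)⁻¹) ^ 2)
    {j : ℕ} (hj : j ≤ k) (z : Site d) (κ : Fin d) :
    ‖((avgIter L (mgauge U₀ (glev L hL1 U₀ (expCfg (iEta η A)) k 0) (expCfg (iEta η A)) * U₀) j z κ : 𝔸ˣ) : 𝔸)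
        - ((avgIter L U₀ j z κ : 𝔸ˣ) : 𝔸)‖ ≤ 530 * (d : ℝ) * α₂ := by
  obtain ⟨hscale, hb, hBn, hBu, hα', hα3', hα4', h52, hsmall, hc₃, hsm, hαP, hαP3, hαP2, hP, -, -⟩ :=
    standing hd hL hL1 k hη hα₀ hα₀c hα₂ hα₂c hU₀ h139 hAh hA hG
  have h := norm_avgIter_fixed_sub_le_all hd hL hU₀ hBu hα' hα3' hα4' h52 hb hBn hsmall hc₃ hsm hαP hαP3 hαP2 hP hL1 hj z κ
  rwa [hscale] at h

variable (d) in
/-- **PROPOSITION 7 PROVED FOR THE ADMITTED FAMILY (model instance of the repaired leaf with `C = 3`)**: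
`B8Ineq145.Prop7RepairedC 3 (admittedGF d L 𝔸) (toAxialGF d L _ 𝔸)` — *"If the configurations U₀, A satisfy (1.139), (1.140), then
for α₀, α₂ sufficiently small we have U′U₀ = (U₁U₀)^u ∈ 𝔄_k({Ω_j}, α₀ + 3α₂) ∩ Ax_k(𝔅_k, U₀), (1.144)  |(U′U₀)‾ʲ − Ū₀ʲ| = |exp iQ_j(U₀, ηA)
− 1| < 2α₂ on Ω_j^{(j)} (1.145)"* with (1.145) read as (1.35) on `Λ_j` at constant `3α₂` (the kernel gives `≤ |Q_k(U₀, ηA)| ≤ 2α₂ <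
3α₂` from the non-strict (131)/(1.143) of the tree; print's strict `2α₂` is recovered below by the strict (24): `prop7PrintedR_admitted`,
`prop7RepairedC_admitted_of_two_le`) — for EVERY `k`, EVERY
`η > 0`, every `d ≥ 1`, `L ≥ 2`, every C⋆-algebra `𝔸` with `G = U(𝔸)`, threshold `c = cst d L`.  By `B8Ineq145.prop7RepairedC_mono` it
holds for every `C ≥ 3` (in particular the cell's adjudicated constants `2dL`, `2 + 8dLe^{2dLc}` when these are `≥ 3`).
[cite: Balaban1985RegularSpaces, Prop. 7 (1.144)–(1.145) p.100] -/
theorem prop7RepairedC_admitted (hd : 1 ≤ d) {L : ℕ} (hL : 2 ≤ L) (hL1 : 1 ≤ L) :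
    B8Ineq145.Prop7RepairedC 3 (admittedGF d L 𝔸) (toAxialGF d L hL1 𝔸) := by
  dsimp only [B8Ineq145.Prop7RepairedC, admittedGF, toAxialGF]
  refine ⟨cst d L, cst_pos hd L hL1, ?_⟩
  intro i α₀ α₂ hα₀ hα₀c hα₂ hα₂c U₀ U₁ h139 h140
  obtain ⟨A, hAh, hU₁, h140⟩ := h140
  subst hU₁
  have hη : (0 : ℝ) < (i.2 : ℝ) := i.2.2
  -- (1.140) at the top level, in the units of the inputs
  have hLk : (0 : ℝ) < (L : ℝ) ^ i.1 * (i.2 : ℝ) := by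
    have : (0 : ℝ) < L := by exact_mod_cast (lt_of_lt_of_le (by norm_num) hL1)
    positivity
  have h140k := h140 i.1 le_rfl
  have hA : ∀ y κ, ‖A y κ‖ ≤ α₂ * ((L : ℝ) ^ i.1 * (i.2 : ℝ))⁻¹ := fun y κ => by
    rw [← div_eq_mul_inv, le_div_iff₀ hLk]
    linarith [(h140k y κ).1, mul_comm ((L : ℝ) ^ i.1 * (i.2 : ℝ)) ‖A y κ‖]
  have hG : ∀ (y : Site d) (κ τ : Fin d),
      ‖covDerivFwd (i.2 : ℝ) U₀.1 κ (fun z => A z τ) y‖ ≤ α₂ * (((L : ℝ) ^ i.1 * (i.2 : ℝ))⁻¹) ^ 2 := fun y κ τ => by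
    rw [inv_pow, ← div_eq_mul_inv, le_div_iff₀ (by positivity)]
    linarith [(h140k y κ).2.1 τ,
      mul_comm (((L : ℝ) ^ i.1 * (i.2 : ℝ)) ^ 2) ‖covDerivFwd (i.2 : ℝ) U₀.1 κ (fun z => A z τ) y‖]
  have hDDA : ∀ (y : Site d) (κ : Fin d),
      ‖pdiv (i.2 : ℝ) U₀.1 (plaqCovDeriv (i.2 : ℝ) U₀.1 A) κ y‖ ≤ α₂ * (((L : ℝ) ^ i.1 * (i.2 : ℝ))⁻¹) ^ 3 :=
    fun y κ => by
    rw [inv_pow, ← div_eq_mul_inv, le_div_iff₀ (by positivity)]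
    linarith [(h140k y κ).2.2,
      mul_comm (((L : ℝ) ^ i.1 * (i.2 : ℝ)) ^ 3) ‖pdiv (i.2 : ℝ) U₀.1 (plaqCovDeriv (i.2 : ℝ) U₀.1 A) κ y‖]
  obtain ⟨-, hAk, hAx, -, hcl⟩ :=
    prop7_admitted_explicit hd hL hL1 i.1 hη hα₀ hα₀c hα₂ hα₂c U₀.2 h139 hAh hA hG hDDA
  refine ⟨⟨hAk _, hAx⟩, fun j hj z κ hbond => ?_⟩
  obtain rfl := eq_of_bondTouches_lamTop hbond
  exact (hcl z κ).trans_lt (by linarith)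

variable (d) in
/-- … hence for EVERY constant `C ≥ 3` (`B8Ineq145.prop7RepairedC_mono`; (1.35) is monotone in its constant on these carriers) — in
particular with the cell's adjudicated constants `2dL` (`dL ≥ 2`) and `2 + 8dLe^{2dLc}` of `B8Ineq145` §3.
[cite: Balaban1985RegularSpaces, Prop. 7 (1.144)–(1.145) p.100] -/
theorem prop7RepairedC_admitted_of_le (hd : 1 ≤ d) {L : ℕ} (hL : 2 ≤ L) (hL1 : 1 ≤ L) {C : ℝ} (hC : 3 ≤ C) :
    B8Ineq145.Prop7RepairedC C (admittedGF d L 𝔸) (toAxialGF d L hL1 𝔸) := by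
  refine B8Ineq145.prop7RepairedC_mono hC _ _ (fun i a a' U₀ U' haa' h => ?_) (prop7RepairedC_admitted d hd hL hL1)
  dsimp only [admittedGF] at h ⊢
  exact fun j hj z κ hb => (h j hj z κ hb).trans_le haa'

/-- **(1.145) ↦ (1.35) at level `k` with print's STRICT constant `2α₂`, all inputs explicit**: under the hypotheses of
`prop7_admitted_explicit` minus the third member of (1.140), `|(U′U₀)‾ᵏ_b − (Ū₀ᵏ)_b| < 2α₂` at EVERY bond `b` of `T^{(k)}`
(`norm_avgIter_fixed_sub_lt` with `Lᵏb = α₂ > 0`: the strict (24) closes the gap left by the non-strict (131)/(1.143) @gen).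
[cite: Balaban1985RegularSpaces, Prop. 7 (1.145) p.100, (1.35) p.82] -/
theorem ineq145_top_strict_admitted_explicit (hd : 1 ≤ d) {L : ℕ} (hL : 2 ≤ L) (hL1 : 1 ≤ L) (k : ℕ) {η : ℝ} (hη : 0 < η)
    {α₀ α₂ : ℝ} (hα₀ : 0 < α₀) (hα₀c : α₀ ≤ cst d L) (hα₂ : 0 < α₂) (hα₂c : α₂ ≤ cst d L)
    {U₀ : Site d → Fin d → 𝔸ˣ} (hU₀ : ∀ x κ, U₀ x κ ∈ unitaryUnits 𝔸) (h139 : InAk L k η α₀ (fun _ => Set.univ) U₀)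
    {A : Site d → Fin d → 𝔸} (hAh : ∀ y κ, IsSelfAdjoint (A y κ))
    (hA : ∀ y κ, ‖A y κ‖ ≤ α₂ * ((L : ℝ) ^ k * η)⁻¹)
    (hG : ∀ (y : Site d) (κ τ : Fin d), ‖covDerivFwd η U₀ κ (fun z => A z τ) y‖ ≤ α₂ * (((L : ℝ) ^ k * η)⁻¹) ^ 2)
    (z : Site d) (κ : Fin d) :
    ‖((avgIter L (mgauge U₀ (glev L hL1 U₀ (expCfg (iEta η A)) k 0) (expCfg (iEta η A)) * U₀) k z κ : 𝔸ˣ) : 𝔸)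
        - ((avgIter L U₀ k z κ : 𝔸ˣ) : 𝔸)‖ < 2 * α₂ := by
  obtain ⟨hscale, hb, hBn, hBu, hα', hα3', hα4', h52, hsmall, hc₃, hsm, hαP, hαP3, hαP2, hP, -, -⟩ :=
    standing hd hL hL1 k hη hα₀ hα₀c hα₂ hα₂c hU₀ h139 hAh hA hG
  have hpos : 0 < (L : ℝ) ^ k * (η * (α₂ * ((L : ℝ) ^ k * η)⁻¹)) := by rw [hscale]; exact hα₂
  have h := norm_avgIter_fixed_sub_lt hd hL hU₀ hBu hα' hα3' hα4' h52 hb hBn hsmall hc₃ hsm hαP hαP3 hαP2 hP hL1 hpos z κ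
  rwa [hscale] at h

/-- **THE DISPLAY (1.145) AT LEVEL `k`, AS PRINTED, all inputs explicit** — «|(U′U₀)‾ᵏ − Ū₀ᵏ| = |exp iQ_k(U₀, ηA) − 1| < 2α₂ on
Ω_k^{(k)}» for the admitted family (`Ω_k^{(k)} = T^{(k)}`, every bond): (a) the EQUALITY (`norm_avgIter_fixed_sub_eq`), (b) (1.143)
«|Q_k(U₀, ηA)| < 2α₂» in the tree's non-strict form `≤ 2α₂` (Prop. 4 of [3] @gen), (c) the STRICT bound `|exp iQ_k − 1| < 2α₂`
(strict (24)).  Here `Q_k(U₀, ηA) = B7Prop4GeneralLevels.logCovIter L U₀ (iηA) k` ((159) of [3]).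
[cite: Balaban1985RegularSpaces, Prop. 7 (1.145) p.100, (1.143) p.100; Balaban1985Averaging, (159)–(161) p.42, (24) p.21] -/
theorem display145_top_admitted_explicit (hd : 1 ≤ d) {L : ℕ} (hL : 2 ≤ L) (hL1 : 1 ≤ L) (k : ℕ) {η : ℝ} (hη : 0 < η)
    {α₀ α₂ : ℝ} (hα₀ : 0 < α₀) (hα₀c : α₀ ≤ cst d L) (hα₂ : 0 < α₂) (hα₂c : α₂ ≤ cst d L)
    {U₀ : Site d → Fin d → 𝔸ˣ} (hU₀ : ∀ x κ, U₀ x κ ∈ unitaryUnits 𝔸) (h139 : InAk L k η α₀ (fun _ => Set.univ) U₀)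
    {A : Site d → Fin d → 𝔸} (hAh : ∀ y κ, IsSelfAdjoint (A y κ))
    (hA : ∀ y κ, ‖A y κ‖ ≤ α₂ * ((L : ℝ) ^ k * η)⁻¹)
    (hG : ∀ (y : Site d) (κ τ : Fin d), ‖covDerivFwd η U₀ κ (fun z => A z τ) y‖ ≤ α₂ * (((L : ℝ) ^ k * η)⁻¹) ^ 2)
    (z : Site d) (κ : Fin d) :
    ‖((avgIter L (mgauge U₀ (glev L hL1 U₀ (expCfg (iEta η A)) k 0) (expCfg (iEta η A)) * U₀) k z κ : 𝔸ˣ) : 𝔸)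
        - ((avgIter L U₀ k z κ : 𝔸ˣ) : 𝔸)‖ = ‖exp (logCovIter L U₀ (iEta η A) k z κ) - 1‖ ∧
    ‖logCovIter L U₀ (iEta η A) k z κ‖ ≤ 2 * α₂ ∧
    ‖exp (logCovIter L U₀ (iEta η A) k z κ) - 1‖ < 2 * α₂ := by
  obtain ⟨hscale, hb, hBn, hBu, hα', hα3', hα4', h52, hsmall, hc₃, hsm, hαP, hαP3, hαP2, hP, -, -⟩ :=
    standing hd hL hL1 k hη hα₀ hα₀c hα₂ hα₂c hU₀ h139 hAh hA hG
  have heq := norm_avgIter_fixed_sub_eq hL hU₀ hα' hα3' hα4' h52 hb hBn hsmall hc₃ hL1 z κ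
  obtain ⟨-, -, hQ⟩ := level_facts hL (avgClosed_unitaryUnits d L) hU₀ hα' hα3' hα4' h52 hb hBn hsmall hc₃ k le_rfl
  have hQ' : ‖logCovIter L U₀ (iEta η A) k z κ‖ ≤ 2 * α₂ := by
    have h := hQ z κ
    rwa [hscale] at h
  have hpos : 0 < (L : ℝ) ^ k * (η * (α₂ * ((L : ℝ) ^ k * η)⁻¹)) := by rw [hscale]; exact hα₂
  have hlt := norm_avgIter_fixed_sub_lt hd hL hU₀ hBu hα' hα3' hα4' h52 hb hBn hsmall hc₃ hsm hαP hαP3 hαP2 hP hL1 hpos z κ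
  rw [hscale] at hlt
  exact ⟨heq, hQ', heq ▸ hlt⟩

variable (d) in
/-- **THE TYPED PRINTED PROPOSITION 7 (pv17's faithful form `B8SectGH.Prop7PrintedR`, constant `2α₂` STRICT) HOLDS FOR THE ADMITTED
FAMILY**: `B8SectGH.Prop7PrintedR (admittedGF d L 𝔸) (toAxialGF d L _ 𝔸)` — *"If the configurations U₀, A satisfy (1.139), (1.140),
then for α₀, α₂ sufficiently small we have U′U₀ = (U₁U₀)^u ∈ 𝔄_k({Ω_j}, α₀ + 3α₂) ∩ Ax_k(𝔅_k, U₀), (1.144)  |(U′U₀)‾ʲ − Ū₀ʲ| =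
|exp iQ_j(U₀, ηA) − 1| < 2α₂ on Ω_j^{(j)} (1.145)"*, (1.145) read (as the typed leaf does, D-pv17.4) as (1.35) «on Λ_j» with the PRINTED
constant `2α₂`, for every `k`, `η > 0`, `d ≥ 1`, `L ≥ 2`, C⋆-algebra `𝔸`, `G = U(𝔸)`, threshold `c = cst d L`.  For this family
`Λ_j = ∅` (`j < k`), `Λ_k = T^{(k)}`, every level-`k` bond is interior, and there the right member of (1.145) is print's own
`|exp iQ_k − 1| < 2α₂` — strict by the strict (24) even though the tree's (1.143) is `≤`.  Contrast: the SAME typed sentence is FALSE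
for the half-space family (`B8Ineq145Lineage.not_prop7Printed_lineage`, r1 form; bonds crossing `∂Λ_j`, GAPS G-B8-01 (b)).
[cite: Balaban1985RegularSpaces, Prop. 7 (1.144)–(1.145) p.100, (1.35) p.82, p.77 («Ω_j = T_η»)] -/
theorem prop7PrintedR_admitted (hd : 1 ≤ d) {L : ℕ} (hL : 2 ≤ L) (hL1 : 1 ≤ L) :
    B8SectGH.Prop7PrintedR (admittedGF d L 𝔸) (toAxialGF d L hL1 𝔸) := by
  dsimp only [B8SectGH.Prop7PrintedR, admittedGF, toAxialGF]
  refine ⟨cst d L, cst_pos hd L hL1, ?_⟩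
  intro i α₀ α₂ hα₀ hα₀c hα₂ hα₂c U₀ U₁ h139 h140
  obtain ⟨A, hAh, hU₁, h140⟩ := h140
  subst hU₁
  have hη : (0 : ℝ) < (i.2 : ℝ) := i.2.2
  have hLk : (0 : ℝ) < (L : ℝ) ^ i.1 * (i.2 : ℝ) := by
    have : (0 : ℝ) < L := by exact_mod_cast (lt_of_lt_of_le (by norm_num) hL1)
    positivity
  have h140k := h140 i.1 le_rfl
  have hA : ∀ y κ, ‖A y κ‖ ≤ α₂ * ((L : ℝ) ^ i.1 * (i.2 : ℝ))⁻¹ := fun y κ => by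
    rw [← div_eq_mul_inv, le_div_iff₀ hLk]
    linarith [(h140k y κ).1, mul_comm ((L : ℝ) ^ i.1 * (i.2 : ℝ)) ‖A y κ‖]
  have hG : ∀ (y : Site d) (κ τ : Fin d),
      ‖covDerivFwd (i.2 : ℝ) U₀.1 κ (fun z => A z τ) y‖ ≤ α₂ * (((L : ℝ) ^ i.1 * (i.2 : ℝ))⁻¹) ^ 2 := fun y κ τ => by
    rw [inv_pow, ← div_eq_mul_inv, le_div_iff₀ (by positivity)]
    linarith [(h140k y κ).2.1 τ,
      mul_comm (((L : ℝ) ^ i.1 * (i.2 : ℝ)) ^ 2) ‖covDerivFwd (i.2 : ℝ) U₀.1 κ (fun z => A z τ) y‖]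
  have hDDA : ∀ (y : Site d) (κ : Fin d),
      ‖pdiv (i.2 : ℝ) U₀.1 (plaqCovDeriv (i.2 : ℝ) U₀.1 A) κ y‖ ≤ α₂ * (((L : ℝ) ^ i.1 * (i.2 : ℝ))⁻¹) ^ 3 :=
    fun y κ => by
    rw [inv_pow, ← div_eq_mul_inv, le_div_iff₀ (by positivity)]
    linarith [(h140k y κ).2.2,
      mul_comm (((L : ℝ) ^ i.1 * (i.2 : ℝ)) ^ 3) ‖pdiv (i.2 : ℝ) U₀.1 (plaqCovDeriv (i.2 : ℝ) U₀.1 A) κ y‖]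
  obtain ⟨-, hAk, hAx, -, -⟩ :=
    prop7_admitted_explicit hd hL hL1 i.1 hη hα₀ hα₀c hα₂ hα₂c U₀.2 h139 hAh hA hG hDDA
  refine ⟨⟨hAk _, hAx⟩, fun j hj z κ hbond => ?_⟩
  obtain rfl := eq_of_bondTouches_lamTop hbond
  exact ineq145_top_strict_admitted_explicit hd hL hL1 i.1 hη hα₀ hα₀c hα₂ hα₂c U₀.2 h139 hAh hA hG z κ

variable (d) in
/-- … and therefore the repaired leaf for EVERY `C ≥ 2` (`B8Ineq145.prop7RepairedC_of_printedR`: the repair weakens), improving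
`prop7RepairedC_admitted_of_le` (`C ≥ 3`). [cite: Balaban1985RegularSpaces, Prop. 7 (1.144)–(1.145) p.100] -/
theorem prop7RepairedC_admitted_of_two_le (hd : 1 ≤ d) {L : ℕ} (hL : 2 ≤ L) (hL1 : 1 ≤ L) {C : ℝ} (hC : 2 ≤ C) :
    B8Ineq145.Prop7RepairedC C (admittedGF d L 𝔸) (toAxialGF d L hL1 𝔸) := by
  refine B8Ineq145.prop7RepairedC_of_printedR C hC _ _ (fun i a a' U₀ U' haa' h => ?_) (prop7PrintedR_admitted d hd hL hL1)
  dsimp only [admittedGF] at h ⊢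
  exact fun j hj z κ hb => (h j hj z κ hb).trans_le haa'

end Model


end Literature.MathematicalPhysics.QuantumFieldTheory.Balaban1983to89.B8Prop7AdmittedFamily

end
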